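import Mathlib
import Literature.RingTheory.MvPolynomial.Directrix
import Literature.Computability.AlgebraicComplexity.DepthThreeVariableReduction
import HarnessLib

/-!
# Blackbox identity testing for depth-3 circuits: the variable reduction (Saxena–Seshadhri 2012)

This file proves the named fact
`Literature.Computability.AlgebraicComplexity.SaxenaSeshadhri2012_lemma11`
(N. Saxena, C. Seshadhri, *Blackbox identity testing for bounded top-fanin depth-3 circuits: the
field doesn't matter*, STOC 2011 / SIAM J. Comput. 41 (2012), Lemma 11 with Theorem 6,
Lemmas 7–10 and Claim 12): a nonzero `ΣΠΣ(k, d, n)` circuit stays nonzero under the Vandermonde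
substitution `x_i ↦ Σ_j β^{ij} y_j` for some `β` in any set of `d n k² + 1` field elements.

## The printed proof and how it is formalised

* **§3.2 / Appendix A, Lemma 7** (`Ψ_β` preserves the rank of `≤ k` forms for all but `n k²`
  values of `β`; proof by row reduction to an echelon basis and the unique permutation of maximal
  degree).  We prove the *generic* version with `β` replaced by an indeterminate `t`
  (`det_vdmExpand_ne_zero`, `eq_zero_of_vandermonde_eq_zero`): echelon bases of a space of
  polynomials (`exists_strictMono_basis`) and the strict rearrangement inequality.
* **Appendix B, Lemma 10** (cancellation: `ℓ ∉ radsp(I) ⇒ (ℓ g ∈ I ⇔ g ∈ I)`):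
  `cancel_linForm`, by the deformation `x_i ↦ x_i + λ(e_i) s` instead of a change of coordinates.
* **§4.1, Lemmas 8/9** (`Ψ` reflects ideal membership on `F[ℓ_1,…,ℓ_k]`):
  `mterm_mem_of_map_mem`, via a left inverse of the linear map on the relevant subspace.
* **§3.1, Theorem 6** (= SS10b Theorem 25, the certifying path) together with **§4.2, Lemma 11
  and Claim 12**: merged into one induction on the number of terms (`map_sum_mterm_not_mem`),
  whose two cases are the homogeneity argument `C ≡ α T_1 (mod I)` (`exists_sub_smul_mem`) and
  the ideal Chinese remaindering over the nodes of `T_1` (`mem_formIdeal_insert_of_nodes`,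
  `exists_node`), the latter proved from Lemma 10.
* **Assembly** (`SaxenaSeshadhri2012_lemma11_holds`): the affine circuit of the statement is
  homogenised with an extra variable `x_0 ↦ y_0`, the scalars are extended to `K = F(t)`, the
  abstract theorem gives `Ψ_t(C) ≠ 0`, and since `Ψ_t(C)` has degree `≤ d n k` in `t`, at most
  `d n k < d n k² + 1` values of `β` are bad.  (The statement in the tree allows affine forms and
  terms of degree `≤ d`, as in §1 of the paper; Definition 4 of the paper normalises to exactly `d`
  linear forms, which is what the homogenisation achieves.)

## References

* [SaxenaSeshadhri2012] N. Saxena, C. Seshadhri, SIAM J. Comput. 41(5), 1285–1298 (2012);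
  STOC 2011; arXiv:1011.3234. Lemma 7 (App. A), Lemmas 8–10 (§4.1, App. B), Theorem 6 (§3.1),
  Lemma 11 and Claim 12 (§4.2).
* [SS10b] N. Saxena, C. Seshadhri, From Sylvester–Gallai configurations to rank bounds,
  ECCC TR10-013 (Theorem 25, ideal Chinese remaindering).
-/

noncomputable section

namespace Literature.Computability.AlgebraicComplexity

namespace SaxenaSeshadhri

section Rank

open Polynomial

variable {F : Type*} [Field F] {r : ℕ}

/-- The `r × r` matrix `(p_a(X^{b+1}))_{a,b}` attached to a family of polynomials (the matrix
`B = A · V_{n,k}` of Saxena–Seshadhri 2012, Appendix A, with `β` an indeterminate).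
[cite: SaxenaSeshadhri2012, Appendix A] -/
def vdmExpand (p : Fin r → F[X]) : Matrix (Fin r) (Fin r) F[X] :=
  Matrix.of fun a b => expand F (b.1 + 1) (p a)

/-- Entries of `vdmExpand`. [folklore] -/
@[simp] theorem vdmExpand_apply (p : Fin r → F[X]) (a b : Fin r) :
    vdmExpand p a b = expand F (b.1 + 1) (p a) := rfl

/-- Row operations act on `vdmExpand` by left multiplication. [folklore] -/
theorem vdmExpand_combination (E : Matrix (Fin r) (Fin r) F) (p : Fin r → F[X]) :
    vdmExpand (fun a => ∑ a', E a a' • p a') = E.map C * vdmExpand p := by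
  refine Matrix.ext fun a b => ?_
  simp only [vdmExpand_apply, Matrix.mul_apply, Matrix.map_apply, map_sum, Polynomial.smul_eq_C_mul,
    map_mul, expand_C]

/-- Hence the determinant changes by the (constant) factor `det E`. [folklore] -/
theorem det_vdmExpand_combination (E : Matrix (Fin r) (Fin r) F) (p : Fin r → F[X]) :
    (vdmExpand (fun a => ∑ a', E a a' • p a')).det = C E.det * (vdmExpand p).det := by
  rw [vdmExpand_combination, Matrix.det_mul, RingHom.map_det, RingHom.mapMatrix_apply]

/-- A monotone permutation of `Fin r` is the identity. [folklore] -/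
theorem perm_eq_one_of_strictMono {σ : Equiv.Perm (Fin r)} (h : StrictMono σ) : σ = 1 := by
  have h1 : (σ : Fin r → Fin r) = id :=
    (h.range_inj strictMono_id).mp (by rw [Set.range_id, Set.range_eq_univ.mpr σ.surjective])
  ext i
  exact congrArg Fin.val (congr_fun h1 i)

/-- **The unique permutation of maximal degree** (SS12 Appendix A): for strictly increasing
degrees, `Σ_b deg(q_{σ b})·(b+1)` is maximal only at `σ = id` (strict rearrangement inequality).
[cite: SaxenaSeshadhri2012, Appendix A] -/
theorem sum_natDegree_perm_lt (q : Fin r → F[X]) (hq : StrictMono fun a => (q a).natDegree)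
    {σ : Equiv.Perm (Fin r)} (hσ : σ ≠ 1) :
    ∑ b, (q (σ b)).natDegree * (b.1 + 1) < ∑ b, (q b).natDegree * (b.1 + 1) := by
  have hmono : Monovary (fun a => (q a).natDegree) (fun b : Fin r => b.1 + 1) :=
    fun i j hij => hq.monotone (Fin.le_def.mpr (by simpa using hij.le))
  refine (hmono.sum_comp_perm_mul_lt_sum_mul_iff (σ := σ)).mpr fun hm => hσ ?_
  refine perm_eq_one_of_strictMono fun i j hij => ?_
  have hle : (q (σ i)).natDegree ≤ (q (σ j)).natDegree := hm (by simpa using hij)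
  exact lt_of_le_of_ne (hq.le_iff_le.mp hle) fun h => (ne_of_lt hij) (σ.injective h)

/-- **Saxena–Seshadhri 2012, Appendix A (echelon case).** If the nonzero polynomials `q_a` have
strictly increasing degrees then `det (q_a(X^{b+1})) ≠ 0`: the identity permutation contributes
the unique term of top degree. [cite: SaxenaSeshadhri2012, Appendix A, proof of Lemma 7] -/
theorem det_vdmExpand_ne_zero_of_strictMono (q : Fin r → F[X]) (hq0 : ∀ a, q a ≠ 0)
    (hq : StrictMono fun a => (q a).natDegree) : (vdmExpand q).det ≠ 0 := by
  classical
  set e : Equiv.Perm (Fin r) → ℕ := fun σ => ∑ b, (q (σ b)).natDegree * (b.1 + 1) with he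
  have hne : ∀ (σ : Equiv.Perm (Fin r)) (b : Fin r), vdmExpand q (σ b) b ≠ 0 := fun σ b => by
    rw [vdmExpand_apply]
    exact (expand_ne_zero (Nat.succ_pos _)).mpr (hq0 _)
  have hdeg : ∀ σ : Equiv.Perm (Fin r), (∏ b, vdmExpand q (σ b) b).natDegree = e σ := by
    intro σ
    rw [natDegree_prod _ _ fun b _ => hne σ b]
    exact Finset.sum_congr rfl fun b _ => by rw [vdmExpand_apply, natDegree_expand]
  have hlc : ∀ σ : Equiv.Perm (Fin r),
      (∏ b, vdmExpand q (σ b) b).leadingCoeff = ∏ b, (q (σ b)).leadingCoeff := by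
    intro σ
    rw [leadingCoeff_prod]
    exact Finset.prod_congr rfl fun b _ => by rw [vdmExpand_apply, leadingCoeff_expand (Nat.succ_pos _)]
  have hcoeff : (vdmExpand q).det.coeff (e 1) = ∏ b, (q b).leadingCoeff := by
    rw [Matrix.det_apply, finsetSum_coeff, Finset.sum_eq_single 1]
    · rw [Equiv.Perm.sign_one, one_smul, ← hdeg 1, coeff_natDegree, hlc 1]
      rfl
    · intro σ _ hσ
      rw [coeff_smul, coeff_eq_zero_of_natDegree_lt, smul_zero]
      rw [hdeg σ]
      exact sum_natDegree_perm_lt q hq hσ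
    · intro h
      exact absurd (Finset.mem_univ _) h
  intro hdet
  have h0 := congrArg (fun P : F[X] => P.coeff (e 1)) hdet
  simp only [hcoeff, coeff_zero] at h0
  exact (Finset.prod_ne_zero_iff.mpr fun b _ => leadingCoeff_ne_zero.mpr (hq0 b)) h0

/-- `Fin.snoc` of a strictly increasing tuple and a larger last value is strictly increasing.
[folklore] -/
theorem strictMono_snoc {α : Type*} [Preorder α] {f : Fin r → α} {x : α} (hf : StrictMono f)
    (hx : ∀ a, f a < x) : StrictMono (Fin.snoc f x : Fin (r + 1) → α) := by
  intro i j hij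
  induction j using Fin.lastCases with
  | last =>
    induction i using Fin.lastCases with
    | last => exact absurd hij (lt_irrefl _)
    | cast i => simpa using hx i
  | cast j =>
    induction i using Fin.lastCases with
    | last => exact absurd ((Fin.castSucc_lt_last j).trans hij) (lt_irrefl _)
    | cast i => simpa using hf (Fin.castSucc_lt_castSucc_iff.mp hij)

/-- Degrees are bounded on a finite-dimensional space of polynomials. [folklore] -/
theorem exists_natDegree_le (W : Submodule F F[X]) [FiniteDimensional F W] :
    ∃ D, ∀ w ∈ W, w.natDegree ≤ D := by
  obtain ⟨S, hS⟩ := (Submodule.fg_iff_finiteDimensional W).mpr ‹_›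
  refine ⟨S.sup fun p => p.natDegree, fun w hw => ?_⟩
  have hle : W ≤ Polynomial.degreeLE F ↑(S.sup fun p => p.natDegree) := by
    rw [← hS, Submodule.span_le]
    intro p hp
    rw [SetLike.mem_coe, Polynomial.mem_degreeLE]
    exact degree_le_natDegree.trans (WithBot.coe_le_coe.mpr (Finset.le_sup (f := fun p => p.natDegree) hp))
  exact natDegree_le_iff_degree_le.mpr (Polynomial.mem_degreeLE.mp (hle hw))

/-- A nonzero finite-dimensional space of polynomials has an element of maximal degree.
[folklore] -/
theorem exists_max_natDegree (W : Submodule F F[X]) [FiniteDimensional F W] (hW : W ≠ ⊥) :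
    ∃ w₀ ∈ W, w₀ ≠ 0 ∧ ∀ w ∈ W, w.natDegree ≤ w₀.natDegree := by
  classical
  obtain ⟨D, hD⟩ := exists_natDegree_le W
  obtain ⟨w₁, hw₁W, hw₁0⟩ := (Submodule.ne_bot_iff W).mp hW
  let P : ℕ → Prop := fun m => ∃ w ∈ W, w ≠ 0 ∧ w.natDegree = m
  obtain ⟨w₀, hw₀W, hw₀0, hw₀deg⟩ : P (Nat.findGreatest P D) :=
    Nat.findGreatest_spec (P := P) (hD w₁ hw₁W) ⟨w₁, hw₁W, hw₁0, rfl⟩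
  refine ⟨w₀, hw₀W, hw₀0, fun w hw => ?_⟩
  by_cases hw0 : w = 0
  · simp [hw0]
  · rw [hw₀deg]
    exact Nat.le_findGreatest (P := P) (hD w hw) ⟨w, hw, hw0, rfl⟩

/-- **Echelon bases** (the row reduction of SS12 Appendix A): an `r`-dimensional space of
polynomials has a basis with strictly increasing degrees. [folklore] -/
theorem exists_strictMono_basis : ∀ (r : ℕ) (W : Submodule F F[X]) [FiniteDimensional F W],
    Module.finrank F W = r → ∃ q : Fin r → F[X], (∀ a, q a ∈ W) ∧ (∀ a, q a ≠ 0) ∧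
      LinearIndependent F q ∧ StrictMono fun a => (q a).natDegree := by
  intro r
  induction r with
  | zero =>
    intro W _ _
    exact ⟨Fin.elim0, fun a => a.elim0, fun a => a.elim0, linearIndependent_empty_type,
      fun a => a.elim0⟩
  | succ r ih =>
    intro W _ hW
    have hW0 : W ≠ ⊥ := by
      rintro rfl
      simp at hW
    obtain ⟨w₀, hw₀W, hw₀0, hmax⟩ := exists_max_natDegree W hW0
    set m := w₀.natDegree with hm
    let W' : Submodule F F[X] := W ⊓ Polynomial.degreeLT F m
    haveI : FiniteDimensional F W' := Submodule.finiteDimensional_of_le inf_le_left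
    have hsup : W' ⊔ F ∙ w₀ = W := by
      apply le_antisymm
      · exact sup_le inf_le_left ((Submodule.span_singleton_le_iff_mem _ _).mpr hw₀W)
      · intro w hw
        set c := w.coeff m / w₀.leadingCoeff with hc
        have hw' : w - c • w₀ ∈ W' := by
          refine ⟨sub_mem hw (W.smul_mem c hw₀W), ?_⟩
          show w - c • w₀ ∈ Polynomial.degreeLT F m
          rw [Polynomial.mem_degreeLT, Polynomial.degree_lt_iff_coeff_zero]
          intro m' hm'
          rw [coeff_sub, coeff_smul, smul_eq_mul]
          rcases hm'.lt_or_eq with hlt | heq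
          · rw [coeff_eq_zero_of_natDegree_lt ((hmax w hw).trans_lt hlt),
              coeff_eq_zero_of_natDegree_lt hlt, mul_zero, sub_zero]
          · rw [← heq, hc, hm, coeff_natDegree, div_mul_cancel₀ _ (leadingCoeff_ne_zero.mpr hw₀0),
              sub_self]
        have hweq : w = (w - c • w₀) + c • w₀ := by ring
        rw [hweq]
        exact add_mem (Submodule.mem_sup_left hw')
          (Submodule.mem_sup_right (Submodule.smul_mem _ _ (Submodule.mem_span_singleton_self _)))
    have hinf : W' ⊓ F ∙ w₀ = ⊥ := by
      rw [eq_bot_iff]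
      rintro x ⟨⟨-, hxdeg⟩, hxspan⟩
      obtain ⟨c, rfl⟩ := Submodule.mem_span_singleton.mp hxspan
      by_contra hc0
      have hc : c ≠ 0 := by
        rintro rfl
        exact hc0 (by simp)
      have hxdeg' : (c • w₀).degree < m := Polynomial.mem_degreeLT.mp hxdeg
      rw [Polynomial.smul_eq_C_mul, degree_C_mul hc, hm, degree_eq_natDegree hw₀0] at hxdeg'
      exact lt_irrefl _ hxdeg'
    have hrank : Module.finrank F W' = r := by
      have h1 := Submodule.finrank_sup_add_finrank_inf_eq W' (F ∙ w₀)
      rw [hsup, hinf, finrank_bot, add_zero, hW, finrank_span_singleton hw₀0] at h1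
      omega
    obtain ⟨q', hq'W, hq'0, hq'li, hq'mono⟩ := ih W' hrank
    have hq'deg : ∀ a, (q' a).natDegree < m := fun a => by
      have h2 : q' a ∈ Polynomial.degreeLT F m := (hq'W a).2
      rw [Polynomial.mem_degreeLT] at h2
      exact (natDegree_lt_iff_degree_lt (hq'0 a)).mpr h2
    refine ⟨Fin.snoc q' w₀, fun a => ?_, fun a => ?_, ?_, ?_⟩
    · induction a using Fin.lastCases with
      | last => simpa using hw₀W
      | cast a => simpa using (hq'W a).1
    · induction a using Fin.lastCases with
      | last => simpa using hw₀0
      | cast a => simpa using hq'0 a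
    · refine linearIndependent_finSnoc.mpr ⟨hq'li, fun hmem => ?_⟩
      have hle : Submodule.span F (Set.range q') ≤ W' :=
        Submodule.span_le.mpr (Set.range_subset_iff.mpr hq'W)
      have h2 : w₀ ∈ Polynomial.degreeLT F m := (hle hmem).2
      rw [Polynomial.mem_degreeLT] at h2
      exact lt_irrefl _ ((natDegree_lt_iff_degree_lt hw₀0).mpr h2)
    · have hcomp : (fun a => ((Fin.snoc q' w₀ : Fin (r + 1) → F[X]) a).natDegree) =
          (Fin.snoc (fun a => (q' a).natDegree) m : Fin (r + 1) → ℕ) := by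
        ext a
        induction a using Fin.lastCases with
        | last => simp [hm]
        | cast a => simp
      rw [hcomp]
      exact strictMono_snoc hq'mono hq'deg

/-- **Saxena–Seshadhri 2012, Lemma 7 / Appendix A (generic form).** For `F`-linearly independent
polynomials `p₁, …, p_r`, the matrix `(p_a(X^{b}))_{a, b ≤ r}` is nonsingular: in the printed
proof `det B(β)` is a nonzero polynomial in `β`; here `β` is the indeterminate itself.
[cite: SaxenaSeshadhri2012, Lemma 7 and Appendix A] -/
theorem det_vdmExpand_ne_zero (p : Fin r → F[X]) (hp : LinearIndependent F p) :
    (vdmExpand p).det ≠ 0 := by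
  classical
  let W : Submodule F F[X] := Submodule.span F (Set.range p)
  haveI : FiniteDimensional F W := FiniteDimensional.span_of_finite F (Set.finite_range p)
  have hW : Module.finrank F W = r := by
    rw [finrank_span_eq_card hp, Fintype.card_fin]
  obtain ⟨q, hqW, hq0, -, hqmono⟩ := exists_strictMono_basis r W hW
  have hE : ∀ a, ∃ c : Fin r → F, ∑ a', c a' • p a' = q a := fun a =>
    (Submodule.mem_span_range_iff_exists_fun (R := F)).mp (hqW a)
  choose E hE using hE
  have hq : q = fun a => ∑ a', E a a' • p a' := funext fun a => (hE a).symm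
  have hdetq := det_vdmExpand_ne_zero_of_strictMono q hq0 hqmono
  rw [hq, det_vdmExpand_combination E p] at hdetq
  exact right_ne_zero_of_mul hdetq

/-! ## The Vandermonde map over an extension containing a transcendental `t` -/

section Transcendental

variable {K : Type*} [Field K] [Algebra F K] [Algebra F[X] K] [IsScalarTower F F[X] K]

/-- The polynomial `Σ_i w_i X^{i+1}` attached to a coefficient vector. [folklore] -/
theorem coeff_sum_monomial_succ {n : ℕ} (w : Fin n → F) (i : Fin n) :
    (∑ i' : Fin n, monomial (i'.1 + 1) (w i')).coeff (i.1 + 1) = w i := by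
  rw [finsetSum_coeff, Finset.sum_eq_single i]
  · exact coeff_monomial_same _ _
  · intro i' _ hi'
    rw [coeff_monomial, if_neg]
    exact fun h => hi' (Fin.ext (by omega))
  · intro h
    exact absurd (Finset.mem_univ i) h

/-- **Saxena–Seshadhri 2012, Lemma 7 (Ψ_t preserves `k`-rank), generic form.** If
`t ∈ K ⊇ F` is transcendental over `F` (`F[X] → K` injective) and `w₁, …, w_r ∈ Fⁿ`
(`r ≤ k`) are `F`-linearly independent, then the vectors
`(Σ_i w_{a,i} t^{(i+1)(j+1)})_{j < k} ∈ K^k` are `K`-linearly independent.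
[cite: SaxenaSeshadhri2012, Lemma 7] -/
theorem linearIndependent_vandermondeRows (hinj : Function.Injective (algebraMap F[X] K))
    {n k r : ℕ} (hr : r ≤ k) (w : Fin r → (Fin n → F)) (hw : LinearIndependent F w) :
    LinearIndependent K fun a => fun j : Fin k =>
      ∑ i : Fin n, algebraMap F K (w a i) * algebraMap F[X] K X ^ ((i.1 + 1) * (j.1 + 1)) := by
  classical
  set t : K := algebraMap F[X] K X with ht
  -- the polynomials `p_a = Σ_i w_{a,i} X^{i+1}`
  let P : (Fin n → F) →ₗ[F] F[X] :=
    { toFun := fun v => ∑ i : Fin n, monomial (i.1 + 1) (v i)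
      map_add' := fun v v' => by simp [Finset.sum_add_distrib]
      map_smul' := fun c v => by simp [Finset.smul_sum, smul_monomial] }
  have hPinj : LinearMap.ker P = ⊥ := by
    rw [LinearMap.ker_eq_bot']
    intro v hv
    ext i
    have h1 := congrArg (fun q : F[X] => q.coeff (i.1 + 1)) hv
    change (∑ i' : Fin n, monomial (i'.1 + 1) (v i')).coeff (i.1 + 1) = (0 : F[X]).coeff (i.1 + 1) at h1
    rwa [coeff_sum_monomial_succ, coeff_zero] at h1
  have hp : LinearIndependent F (P ∘ w) := hw.map' P hPinj
  -- entries as images of the expanded polynomials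
  have hentry : ∀ (a : Fin r) (j : Fin k),
      ∑ i : Fin n, algebraMap F K (w a i) * t ^ ((i.1 + 1) * (j.1 + 1)) =
        algebraMap F[X] K (expand F (j.1 + 1) (P (w a))) := by
    intro a j
    simp only [P, LinearMap.coe_mk, AddHom.coe_mk, map_sum, expand_monomial]
    refine Finset.sum_congr rfl fun i _ => ?_
    rw [← C_mul_X_pow_eq_monomial, map_mul, map_pow, ← ht, IsScalarTower.algebraMap_apply F F[X] K,
      Polynomial.algebraMap_eq]
  rw [Fintype.linearIndependent_iff]
  intro c hc a₀
  by_contra hca₀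
  -- restrict to the first `r` columns
  let Mt : Matrix (Fin r) (Fin r) K := (vdmExpand (P ∘ w)).map (algebraMap F[X] K)
  have hvec : Matrix.vecMul c Mt = 0 := by
    ext b
    have hb := congr_fun hc (Fin.castLE hr b)
    simp only [Finset.sum_apply, Pi.smul_apply, smul_eq_mul, Pi.zero_apply] at hb
    change ∑ a, c a * Mt a b = 0
    rw [← hb]
    refine Finset.sum_congr rfl fun a _ => ?_
    rw [hentry a (Fin.castLE hr b)]
    rfl
  have hdet : Mt.det = 0 := Matrix.exists_vecMul_eq_zero_iff.mp ⟨c, fun h => hca₀ (congr_fun h a₀), hvec⟩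
  have hdet' : (vdmExpand (P ∘ w)).det ≠ 0 := det_vdmExpand_ne_zero _ hp
  apply hdet'
  apply hinj
  rw [map_zero, RingHom.map_det, RingHom.mapMatrix_apply]
  exact hdet

omit [Algebra F[X] K] [IsScalarTower F F[X] K] in
/-- `F`-combinations become `K`-combinations after extension of scalars. [folklore] -/
theorem baseChange_mem_span {n : ℕ} (S : Set (Fin n → F)) {x : Fin n → F}
    (hx : x ∈ Submodule.span F S) :
    (fun i => algebraMap F K (x i)) ∈
      Submodule.span K ((fun (w : Fin n → F) (i : Fin n) => algebraMap F K (w i)) '' S) := by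
  induction hx using Submodule.span_induction with
  | mem x hx => exact Submodule.subset_span ⟨x, hx, rfl⟩
  | zero =>
    have h0 : (fun i => algebraMap F K ((0 : Fin n → F) i)) = 0 := by
      ext i
      simp
    rw [h0]
    exact Submodule.zero_mem _
  | add x y _ _ hx hy =>
    have : (fun i => algebraMap F K ((x + y) i)) =
        (fun i => algebraMap F K (x i)) + fun i => algebraMap F K (y i) := by
      ext i; simp
    rw [this]
    exact add_mem hx hy
  | smul c x _ hx =>
    have : (fun i => algebraMap F K ((c • x) i)) = algebraMap F K c • fun i => algebraMap F K (x i) := by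
      ext i; simp
    rw [this]
    exact Submodule.smul_mem _ _ hx

/-- **Injectivity of `Ψ_t` on spans of `≤ k` rational forms** (the form of SS12 Lemma 7 used in
the proof of Lemma 11): if `v ∈ Kⁿ` is a `K`-combination of at most `k` vectors with entries in
`F` and `Σ_i v_i t^{(i+1)(j+1)} = 0` for all `j < k`, then `v = 0`.
[cite: SaxenaSeshadhri2012, Lemma 7] -/
theorem eq_zero_of_vandermonde_eq_zero (hinj : Function.Injective (algebraMap F[X] K))
    {n k : ℕ} (s : Finset (Fin n → F)) (hs : s.card ≤ k) (v : Fin n → K)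
    (hv : v ∈ Submodule.span K ((fun (w : Fin n → F) (i : Fin n) => algebraMap F K (w i)) '' ↑s))
    (h0 : ∀ j : Fin k, ∑ i : Fin n, v i * algebraMap F[X] K X ^ ((i.1 + 1) * (j.1 + 1)) = 0) :
    v = 0 := by
  classical
  set ι : (Fin n → F) → (Fin n → K) := fun w i => algebraMap F K (w i) with hι
  obtain ⟨b, hbs, hbspan, hbli⟩ := exists_linearIndependent F (s : Set (Fin n → F))
  have hbfin : b.Finite := s.finite_toSet.subset hbs
  set r := hbfin.toFinset.card with hr
  have hrk : r ≤ k := (Finset.card_le_card (hbfin.toFinset_subset.mpr hbs)).trans hs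
  -- enumerate `b`
  let w : Fin r → (Fin n → F) := fun a => (hbfin.toFinset.equivFin.symm a).1
  have hwb : ∀ a, w a ∈ b := fun a => hbfin.mem_toFinset.mp (hbfin.toFinset.equivFin.symm a).2
  have hwrange : Set.range w = b := by
    ext x
    constructor
    · rintro ⟨a, rfl⟩
      exact hwb a
    · intro hx
      refine ⟨hbfin.toFinset.equivFin ⟨x, hbfin.mem_toFinset.mpr hx⟩, ?_⟩
      simp [w]
  have hw : LinearIndependent F w := by
    have hcomp : w = ((↑) : b → (Fin n → F)) ∘ fun a => (⟨w a, hwb a⟩ : b) := rfl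
    rw [hcomp]
    refine hbli.comp _ fun a a' h => ?_
    have h' : w a = w a' := congrArg (fun x : b => (x : Fin n → F)) h
    exact hbfin.toFinset.equivFin.symm.injective (Subtype.ext h')
  -- `v` is a `K`-combination of the `ι (w a)`
  have hvspan : v ∈ Submodule.span K (Set.range (ι ∘ w)) := by
    have hle : Submodule.span K (ι '' ↑s) ≤ Submodule.span K (Set.range (ι ∘ w)) := by
      refine Submodule.span_le.mpr ?_
      rintro _ ⟨x, hx, rfl⟩
      have hx' : x ∈ Submodule.span F b := by
        rw [hbspan]
        exact Submodule.subset_span hx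
      have := baseChange_mem_span (K := K) b hx'
      rwa [← hwrange, ← Set.range_comp] at this
    exact hle hv
  obtain ⟨c, rfl⟩ := (Submodule.mem_span_range_iff_exists_fun (R := K)).mp hvspan
  -- the relation becomes a `K`-dependence of the Vandermonde rows
  have hli := linearIndependent_vandermondeRows (K := K) hinj hrk w hw
  rw [Fintype.linearIndependent_iff] at hli
  have hc : ∀ a, c a = 0 := by
    refine hli c ?_
    ext j
    simp only [Finset.sum_apply, Pi.smul_apply, smul_eq_mul, Pi.zero_apply]
    rw [← h0 j]
    simp only [Finset.sum_apply, Pi.smul_apply, smul_eq_mul, Function.comp_apply, hι, Finset.sum_mul,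
      Finset.mul_sum]
    rw [Finset.sum_comm]
    refine Finset.sum_congr rfl fun i _ => Finset.sum_congr rfl fun a _ => ?_
    ring
  simp [hc]

end Transcendental

end Rank

section Ideals

open MvPolynomial

open Literature.RingTheory.MvPolynomial (linForm linForm_apply linForm_single isHomogeneous_linForm)

variable {K : Type*} [Field K] {N M : ℕ}

/-! ## Linear forms: two small helpers -/

/-- A vector is the combination of the standard basis vectors with its entries as
coefficients. [folklore] -/
theorem sum_smul_single (w : Fin N → K) : ∑ j, w j • (Pi.single j (1 : K) : Fin N → K) = w := by
  ext i
  simp [Finset.sum_apply, Pi.single_apply]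

/-- A linear map out of `Kⁿ` is determined by the standard basis. [folklore] -/
theorem linearMap_apply_eq_sum {P : Type*} [AddCommMonoid P] [Module K P]
    (f : (Fin N → K) →ₗ[K] P) (w : Fin N → K) : f w = ∑ j, w j • f (Pi.single j 1) := by
  conv_lhs => rw [← sum_smul_single w]
  simp [map_sum, map_smul]

/-- An algebra map evaluated on a linear form. [folklore] -/
theorem aeval_linForm {A : Type*} [CommSemiring A] [Algebra K A] (g : Fin N → A) (v : Fin N → K) :
    aeval g (linForm v) = ∑ i, v i • g i := by
  rw [linForm_apply, map_sum]
  exact Finset.sum_congr rfl fun i _ => by rw [map_smul, aeval_X]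

/-- An algebra map `X_j ↦ linForm (ψ e_j)` sends `linForm w` to `linForm (ψ w)`. [folklore] -/
theorem aeval_linForm_linForm {P : ℕ} (ψ : (Fin M → K) →ₗ[K] (Fin P → K)) (w : Fin M → K) :
    aeval (fun j => linForm (K := K) (ψ (Pi.single j 1))) (linForm w) = linForm (ψ w) := by
  rw [aeval_linForm, show linForm (ψ w) = (linForm ∘ₗ ψ) w from rfl, linearMap_apply_eq_sum]
  rfl

/-! ## Multiplication terms and the ideals they generate -/

/-- The multiplication term `M(S) = ∏_{ℓ ∈ S} ℓ` of a multiset `S` of linear forms, the forms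
being given by their coefficient vectors (Saxena–Seshadhri 2012, Definition 4).
[cite: SaxenaSeshadhri2012, Definition 4] -/
def mterm (S : Multiset (Fin N → K)) : MvPolynomial (Fin N) K := (S.map linForm).prod

/-- The ideal `⟨M(S) : S ∈ 𝒢⟩` generated by a family of multiplication terms
(Saxena–Seshadhri 2012, §3.1). [cite: SaxenaSeshadhri2012, Section 3.1] -/
def formIdeal (𝒢 : Set (Multiset (Fin N → K))) : Ideal (MvPolynomial (Fin N) K) :=
  Ideal.span (mterm '' 𝒢)

omit [Field K] in
/-- `M(∅) = 1`. [folklore] -/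
@[simp] theorem mterm_zero [Field K] : mterm (0 : Multiset (Fin N → K)) = 1 := by simp [mterm]

/-- `M(a :: S) = ℓ_a · M(S)`. [folklore] -/
@[simp] theorem mterm_cons (a : Fin N → K) (S : Multiset (Fin N → K)) :
    mterm (a ::ₘ S) = linForm a * mterm S := by simp [mterm]

/-- `M(S + T) = M(S) · M(T)`. [folklore] -/
@[simp] theorem mterm_add (S T : Multiset (Fin N → K)) : mterm (S + T) = mterm S * mterm T := by
  simp [mterm]

/-- `M({a}) = ℓ_a`. [folklore] -/
@[simp] theorem mterm_singleton (a : Fin N → K) : mterm ({a} : Multiset (Fin N → K)) = linForm a := by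
  simp [mterm]

/-- `M` of a family indexed by a finite type is the `Finset` product. [folklore] -/
theorem mterm_univ_map {m : ℕ} (f : Fin m → (Fin N → K)) :
    mterm (Finset.univ.val.map f) = ∏ j, linForm (f j) := by
  rw [mterm, Multiset.map_map, Finset.prod_eq_multiset_prod]
  rfl

/-- `M` of a repeated form is a power. [folklore] -/
theorem mterm_replicate (m : ℕ) (v : Fin N → K) : mterm (Multiset.replicate m v) = linForm v ^ m := by
  rw [mterm, Multiset.map_replicate, Multiset.prod_replicate]

/-- `M(S)` is homogeneous of degree `|S|`. [folklore] -/
theorem isHomogeneous_mterm (S : Multiset (Fin N → K)) : (mterm S).IsHomogeneous (Multiset.card S) := by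
  induction S using Multiset.induction_on with
  | empty => simpa using isHomogeneous_one (Fin N) K
  | cons a S ih =>
    rw [mterm_cons, Multiset.card_cons, add_comm]
    exact (isHomogeneous_linForm a).mul ih

/-- A sub-multiset gives a divisor. [folklore] -/
theorem mterm_dvd_of_le {S T : Multiset (Fin N → K)} (h : S ≤ T) : mterm S ∣ mterm T := by
  obtain ⟨U, rfl⟩ := Multiset.le_iff_exists_add.mp h
  exact ⟨mterm U, mterm_add S U⟩

/-- Generators belong to the ideal. [folklore] -/
theorem mterm_mem_formIdeal {𝒢 : Set (Multiset (Fin N → K))} {S : Multiset (Fin N → K)} (h : S ∈ 𝒢) :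
    mterm S ∈ formIdeal 𝒢 :=
  Ideal.subset_span ⟨S, h, rfl⟩

/-- Monotonicity in the generating family. [folklore] -/
theorem formIdeal_mono {𝒢 𝒢' : Set (Multiset (Fin N → K))} (h : 𝒢 ⊆ 𝒢') : formIdeal 𝒢 ≤ formIdeal 𝒢' :=
  Ideal.span_mono (Set.image_mono h)

/-- Membership in `⟨𝒢, M(S)⟩`. [folklore] -/
theorem mem_formIdeal_insert {𝒢 : Set (Multiset (Fin N → K))} {S : Multiset (Fin N → K)}
    {f : MvPolynomial (Fin N) K} :
    f ∈ formIdeal (insert S 𝒢) ↔ ∃ a, ∃ z ∈ formIdeal 𝒢, f = a * mterm S + z := by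
  rw [formIdeal, Set.image_insert_eq, Ideal.mem_span_insert]
  rfl

/-- `⟨𝒢⟩ ≤ ⟨𝒢, S⟩`. [folklore] -/
theorem formIdeal_le_insert (𝒢 : Set (Multiset (Fin N → K))) (S : Multiset (Fin N → K)) :
    formIdeal 𝒢 ≤ formIdeal (insert S 𝒢) :=
  formIdeal_mono (Set.subset_insert _ _)

/-- A multiple of a super-multiset of `S` lies in `⟨𝒢, S⟩`. [folklore] -/
theorem mul_mterm_mem_formIdeal_insert {𝒢 : Set (Multiset (Fin N → K))} {S T : Multiset (Fin N → K)}
    (h : S ≤ T) (a : MvPolynomial (Fin N) K) : a * mterm T ∈ formIdeal (insert S 𝒢) := by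
  obtain ⟨c, hc⟩ := mterm_dvd_of_le h
  rw [hc, ← mul_comm c, ← mul_assoc]
  exact Ideal.mul_mem_left _ _ (mterm_mem_formIdeal (Set.mem_insert _ _))

/-- The image of `⟨𝒢⟩` under a ring map is generated by the images of the generators.
[folklore] -/
theorem map_formIdeal_le_iff {A F : Type*} [CommRing A] [FunLike F (MvPolynomial (Fin N) K) A]
    [RingHomClass F (MvPolynomial (Fin N) K) A] (Φ : F)
    (𝒢 : Set (Multiset (Fin N → K))) (J : Ideal A) :
    (formIdeal 𝒢).map Φ ≤ J ↔ ∀ S ∈ 𝒢, Φ (mterm S) ∈ J := by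
  rw [formIdeal, Ideal.map_span, Ideal.span_le]
  constructor
  · intro h S hS
    exact h ⟨mterm S, ⟨S, hS, rfl⟩, rfl⟩
  · rintro h _ ⟨_, ⟨S, hS, rfl⟩, rfl⟩
    exact h S hS

/-! ## The cancellation lemma (SS12, Lemma 10 = SS10b) -/

/-- **Saxena–Seshadhri 2012, Lemma 10 (cancellation).** If every form occurring in the
generators of `I = ⟨𝒢⟩` lies in the subspace `V` (so `radsp(I) ⊆ V`) and `ℓ_a ∉ V`, then
`ℓ_a · g ∈ I` implies `g ∈ I`.  Proof by the deformation `X_i ↦ X_i + λ(e_i) s` for a functional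
`λ` vanishing on `V` with `λ(a) ≠ 0`, which fixes `I` and moves `ℓ_a` to `ℓ_a + λ(a) s`, followed by
a comparison of coefficients in `s` (this replaces the change of coordinates of the printed proof).
[cite: SaxenaSeshadhri2012, Lemma 10 and Appendix B] -/
theorem cancel_linForm {𝒢 : Set (Multiset (Fin N → K))} {V : Submodule K (Fin N → K)}
    (h𝒢 : ∀ S ∈ 𝒢, ∀ b ∈ S, b ∈ V) {a : Fin N → K} (ha : a ∉ V)
    {g : MvPolynomial (Fin N) K} (h : linForm a * g ∈ formIdeal 𝒢) : g ∈ formIdeal 𝒢 := by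
  obtain ⟨lam, hlama, hlamV⟩ := Submodule.exists_dual_map_eq_bot_of_notMem ha inferInstance
  have hV0 : ∀ v ∈ V, lam v = 0 := fun v hv => by
    have : lam v ∈ V.map lam := Submodule.mem_map_of_mem hv
    rwa [hlamV, Submodule.mem_bot] at this
  -- the deformation
  let θ : MvPolynomial (Fin N) K →ₐ[K] Polynomial (MvPolynomial (Fin N) K) :=
    aeval fun i => Polynomial.C (X i) + Polynomial.C (C (lam (Pi.single i 1))) * Polynomial.X
  have hθlin : ∀ v : Fin N → K, θ (linForm v) =
      Polynomial.C (linForm v) + Polynomial.C (C (lam v)) * Polynomial.X := by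
    intro v
    rw [aeval_linForm, linearMap_apply_eq_sum lam v, linForm_apply, map_sum, map_sum, map_sum,
      Finset.sum_mul, ← Finset.sum_add_distrib]
    refine Finset.sum_congr rfl fun i _ => ?_
    rw [smul_add, Polynomial.smul_C, ← smul_mul_assoc, Polynomial.smul_C, smul_eq_C_mul _ (v i),
      smul_eq_C_mul _ (v i), ← C_mul, smul_eq_mul]
  have hθV : ∀ v ∈ V, θ (linForm v) = Polynomial.C (linForm v) := fun v hv => by
    rw [hθlin, hV0 v hv, C_0, Polynomial.C_0, zero_mul, add_zero]
  have hθmt : ∀ S : Multiset (Fin N → K), (∀ b ∈ S, b ∈ V) →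
      θ (mterm S) = Polynomial.C (mterm S) := by
    intro S hS
    rw [mterm, map_multiset_prod, map_multiset_prod, Multiset.map_map, Multiset.map_map]
    congr 1
    exact Multiset.map_congr rfl fun b hb => hθV b (hS b hb)
  have hθI : ∀ f ∈ formIdeal 𝒢, θ f ∈ (formIdeal 𝒢).map (Polynomial.C) := by
    intro f hf
    have hle : (formIdeal 𝒢).map θ ≤ (formIdeal 𝒢).map Polynomial.C := by
      rw [map_formIdeal_le_iff]
      intro S hS
      rw [hθmt S (h𝒢 S hS)]
      exact Ideal.mem_map_of_mem _ (mterm_mem_formIdeal hS)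
    exact hle (Ideal.mem_map_of_mem _ hf)
  have hθ0 : ∀ f : MvPolynomial (Fin N) K, (θ f).coeff 0 = f := by
    intro f
    have hcomp : (Polynomial.evalRingHom 0).comp
        (θ : MvPolynomial (Fin N) K →+* Polynomial (MvPolynomial (Fin N) K)) = RingHom.id _ := by
      refine MvPolynomial.ringHom_ext (fun c => ?_) (fun i => ?_)
      · simp [θ]
      · simp [θ]
    rw [Polynomial.coeff_zero_eq_eval_zero]
    exact RingHom.congr_fun hcomp f
  -- coefficient comparison
  set G := θ g with hG
  have key : ∀ m, linForm a * G.coeff (m + 1) + C (lam a) * G.coeff m ∈ formIdeal 𝒢 := by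
    intro m
    have hm := (Ideal.mem_map_C_iff.mp (hθI _ h)) (m + 1)
    have hcoeff : (θ (linForm a * g)).coeff (m + 1) =
        linForm a * G.coeff (m + 1) + C (lam a) * G.coeff m := by
      rw [map_mul, hθlin, add_mul, Polynomial.coeff_add, Polynomial.coeff_C_mul, mul_assoc,
        Polynomial.coeff_C_mul, Polynomial.coeff_X_mul]
    rwa [hcoeff] at hm
  have down : ∀ j m, G.natDegree < m + j → G.coeff m ∈ formIdeal 𝒢 := by
    intro j
    induction j with
    | zero =>
      intro m hm
      rw [Polynomial.coeff_eq_zero_of_natDegree_lt (by omega)]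
      exact zero_mem _
    | succ j ih =>
      intro m hm
      have h1 : linForm a * G.coeff (m + 1) ∈ formIdeal 𝒢 :=
        Ideal.mul_mem_left _ _ (ih (m + 1) (by omega))
      have h2 : C (lam a) * G.coeff m ∈ formIdeal 𝒢 := by
        simpa using sub_mem (key m) h1
      have h3 := Ideal.mul_mem_left _ (C (lam a)⁻¹) h2
      rwa [← mul_assoc, ← C_mul, inv_mul_cancel₀ hlama, C_1, one_mul] at h3
  have h0 := down (G.natDegree + 1) 0 (by omega)
  rwa [hG, hθ0] at h0

/-- Iterated cancellation: a product of forms outside `V` can be cancelled.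
[cite: SaxenaSeshadhri2012, Lemma 10] -/
theorem cancel_mterm {𝒢 : Set (Multiset (Fin N → K))} {V : Submodule K (Fin N → K)}
    (h𝒢 : ∀ S ∈ 𝒢, ∀ b ∈ S, b ∈ V) {w : Multiset (Fin N → K)} (hw : ∀ c ∈ w, c ∉ V)
    {g : MvPolynomial (Fin N) K} (h : mterm w * g ∈ formIdeal 𝒢) : g ∈ formIdeal 𝒢 := by
  induction w using Multiset.induction_on generalizing g with
  | empty => simpa using h
  | cons c w ih =>
    have hc : c ∉ V := hw c (Multiset.mem_cons_self c w)
    rw [mterm_cons, mul_assoc] at h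
    exact ih (fun c' hc' => hw c' (Multiset.mem_cons_of_mem hc')) (cancel_linForm h𝒢 hc h)

/-! ## Reflection of ideal membership on a low-rank subalgebra (SS12, Lemmas 8 and 9) -/

/-- **Saxena–Seshadhri 2012, Lemmas 8/9 (Ψ preserves ideals), abstract form.** Let `Φ` be an
algebra map acting on linear forms through the linear map `φ`, and suppose `φ` is injective on
the subspace `V` containing every form of the generators of `I = ⟨𝒢⟩` and of the term `M(S₀)`.
Then `Φ(M(S₀)) ∈ Φ(I)` implies `M(S₀) ∈ I`.  (The printed proof shows that `Φ` induces an
isomorphism `F[ℓ_1,…,ℓ_k] ≅ R'`; here a left inverse `ψ` of `φ|_V` gives an algebra map `Ψ`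
with `Ψ ∘ Φ = id` on `F[V]`, which suffices.) [cite: SaxenaSeshadhri2012, Lemmas 8 and 9] -/
theorem mterm_mem_of_map_mem (Φ : MvPolynomial (Fin N) K →ₐ[K] MvPolynomial (Fin M) K)
    (φ : (Fin N → K) →ₗ[K] (Fin M → K)) (hΦ : ∀ v, Φ (linForm v) = linForm (φ v))
    {𝒢 : Set (Multiset (Fin N → K))} {V : Submodule K (Fin N → K)}
    (h𝒢 : ∀ S ∈ 𝒢, ∀ b ∈ S, b ∈ V) (hinj : ∀ v ∈ V, φ v = 0 → v = 0)
    {S₀ : Multiset (Fin N → K)} (hS₀ : ∀ b ∈ S₀, b ∈ V)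
    (h : Φ (mterm S₀) ∈ (formIdeal 𝒢).map Φ) : mterm S₀ ∈ formIdeal 𝒢 := by
  -- a left inverse of `φ` on `V`
  have hker : LinearMap.ker (φ.domRestrict V) = ⊥ := by
    rw [LinearMap.ker_eq_bot']
    rintro ⟨v, hv⟩ h0
    exact Subtype.ext (hinj v hv h0)
  obtain ⟨ψ₀, hψ₀⟩ := LinearMap.exists_leftInverse_of_injective (φ.domRestrict V) hker
  let ψ : (Fin M → K) →ₗ[K] (Fin N → K) := V.subtype ∘ₗ ψ₀
  have hψ : ∀ v ∈ V, ψ (φ v) = v := fun v hv => by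
    have h1 := LinearMap.congr_fun hψ₀ ⟨v, hv⟩
    rw [LinearMap.comp_apply, LinearMap.domRestrict_apply, LinearMap.id_apply] at h1
    show (ψ₀ (φ v) : Fin N → K) = v
    rw [h1]
  let Ψ : MvPolynomial (Fin M) K →ₐ[K] MvPolynomial (Fin N) K :=
    aeval fun j => linForm (K := K) (ψ (Pi.single j 1))
  have hfix : ∀ v ∈ V, Ψ (Φ (linForm v)) = linForm v := fun v hv => by
    rw [hΦ, aeval_linForm_linForm ψ (φ v), hψ v hv]
  have hfixS : ∀ S : Multiset (Fin N → K), (∀ b ∈ S, b ∈ V) → Ψ (Φ (mterm S)) = mterm S := by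
    intro S hS
    rw [mterm, map_multiset_prod, map_multiset_prod, Multiset.map_map, Multiset.map_map]
    congr 1
    exact Multiset.map_congr rfl fun b hb => hfix b (hS b hb)
  have hle : ((formIdeal 𝒢).map Φ).map Ψ ≤ formIdeal 𝒢 := by
    rw [Ideal.map_le_iff_le_comap, map_formIdeal_le_iff]
    intro S hS
    rw [Ideal.mem_comap, hfixS S (h𝒢 S hS)]
    exact mterm_mem_formIdeal hS
  have h2 := hle (Ideal.mem_map_of_mem Ψ h)
  rwa [hfixS S₀ hS₀] at h2


/-- An algebra map acting linearly on forms maps multiplication terms to multiplication terms.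
[folklore] -/
theorem map_mterm (Φ : MvPolynomial (Fin N) K →ₐ[K] MvPolynomial (Fin M) K)
    (φ : (Fin N → K) →ₗ[K] (Fin M → K)) (hΦ : ∀ v, Φ (linForm v) = linForm (φ v))
    (S : Multiset (Fin N → K)) : Φ (mterm S) = mterm (S.map φ) := by
  rw [mterm, mterm, map_multiset_prod, Multiset.map_map, Multiset.map_map]
  congr 1
  exact Multiset.map_congr rfl fun b _ => hΦ b

/-- The image of `⟨𝒢⟩` under such a map is `⟨φ(𝒢)⟩`. [folklore] -/
theorem map_formIdeal (Φ : MvPolynomial (Fin N) K →ₐ[K] MvPolynomial (Fin M) K)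
    (φ : (Fin N → K) →ₗ[K] (Fin M → K)) (hΦ : ∀ v, Φ (linForm v) = linForm (φ v))
    (𝒢 : Set (Multiset (Fin N → K))) :
    (formIdeal 𝒢).map Φ = formIdeal ((Multiset.map φ) '' 𝒢) := by
  rw [formIdeal, formIdeal, Ideal.map_span, Set.image_image, Set.image_image]
  congr 1
  exact Set.image_congr fun S _ => map_mterm Φ φ hΦ S

/-! ## Ideal Chinese remaindering over the nodes of a term (SS10b, used in SS12 Theorem 6) -/

/-- Two products of forms that are "coprime modulo `V`" — every form of `u` lies outside `V`
and no form of `w` is similar modulo `V` to a form of `u` — satisfy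
`⟨𝒢, M(u)⟩ ∩ ⟨𝒢, M(w)⟩ ⊆ ⟨𝒢, M(u + w)⟩`.  Proved from the cancellation lemma by induction on
`u`. [cite: SaxenaSeshadhri2012, Section 3.1 (paths and nodes, after SS10b)] -/
theorem mem_formIdeal_insert_add {𝒢 : Set (Multiset (Fin N → K))} {V : Submodule K (Fin N → K)}
    (h𝒢 : ∀ S ∈ 𝒢, ∀ b ∈ S, b ∈ V) {u w : Multiset (Fin N → K)} (hu : ∀ a ∈ u, a ∉ V)
    (huw : ∀ c ∈ w, ∀ a ∈ u, c ∉ V ⊔ K ∙ a) {f : MvPolynomial (Fin N) K}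
    (hfu : f ∈ formIdeal (insert u 𝒢)) (hfw : f ∈ formIdeal (insert w 𝒢)) :
    f ∈ formIdeal (insert (u + w) 𝒢) := by
  induction u using Multiset.induction_on generalizing f with
  | empty => simpa using hfw
  | cons a u ih =>
    have ha : a ∉ V := hu a (Multiset.mem_cons_self a u)
    obtain ⟨β, z₁, hz₁, rfl⟩ := mem_formIdeal_insert.mp hfw
    obtain ⟨γ, z₂, hz₂, hfγ⟩ := mem_formIdeal_insert.mp hfu
    -- Step 1: `β · M(w) ∈ ⟨𝒢, ℓ_a⟩`, hence `β ∈ ⟨𝒢, ℓ_a⟩` by cancellation of the forms of `w`.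
    have h1 : mterm w * β ∈ formIdeal (insert {a} 𝒢) := by
      have hβ : mterm w * β = γ * mterm (a ::ₘ u) + z₂ - z₁ := by linear_combination hfγ
      rw [hβ]
      refine sub_mem (add_mem ?_ (formIdeal_le_insert _ _ hz₂)) (formIdeal_le_insert _ _ hz₁)
      exact mul_mterm_mem_formIdeal_insert (Multiset.singleton_le.mpr (Multiset.mem_cons_self a u)) γ
    have h𝒢a : ∀ S ∈ insert ({a} : Multiset (Fin N → K)) 𝒢, ∀ b ∈ S, b ∈ V ⊔ K ∙ a := by
      rintro S (rfl | hS) b hb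
      · rw [Multiset.mem_singleton] at hb
        subst hb
        exact Submodule.mem_sup_right (Submodule.mem_span_singleton_self _)
      · exact Submodule.mem_sup_left (h𝒢 S hS b hb)
    have hwVa : ∀ c ∈ w, c ∉ V ⊔ K ∙ a := fun c hc => huw c hc a (Multiset.mem_cons_self a u)
    obtain ⟨β', z₃, hz₃, rfl⟩ := mem_formIdeal_insert.mp (cancel_mterm h𝒢a hwVa h1)
    -- Step 2: cancel `ℓ_a`.
    have h3 : linForm a * (β' * mterm w - γ * mterm u) ∈ formIdeal 𝒢 := by
      have h3' : linForm a * (β' * mterm w - γ * mterm u) = z₂ - z₁ - z₃ * mterm w := by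
        rw [mterm_singleton, mterm_cons] at hfγ
        linear_combination hfγ
      rw [h3']
      exact sub_mem (sub_mem hz₂ hz₁) (Ideal.mul_mem_right _ _ hz₃)
    have h4 : β' * mterm w - γ * mterm u ∈ formIdeal 𝒢 := cancel_linForm h𝒢 ha h3
    -- Step 3: induction hypothesis for `β' · M(w) ∈ ⟨𝒢, M(u)⟩ ∩ ⟨𝒢, M(w)⟩`.
    have h5w : β' * mterm w ∈ formIdeal (insert w 𝒢) := mul_mterm_mem_formIdeal_insert le_rfl β'
    have h5u : β' * mterm w ∈ formIdeal (insert u 𝒢) := by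
      have h5' : β' * mterm w = γ * mterm u + (β' * mterm w - γ * mterm u) := by ring
      rw [h5']
      exact add_mem (mul_mterm_mem_formIdeal_insert le_rfl γ) (formIdeal_le_insert _ _ h4)
    have h6 := ih (fun a' ha' => hu a' (Multiset.mem_cons_of_mem ha'))
      (fun c hc a' ha' => huw c hc a' (Multiset.mem_cons_of_mem ha')) h5u h5w
    obtain ⟨δ, z₄, hz₄, hδ⟩ := mem_formIdeal_insert.mp h6
    rw [mem_formIdeal_insert]
    refine ⟨δ, linForm a * z₄ + z₃ * mterm w + z₁, ?_, ?_⟩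
    · exact add_mem (add_mem (Ideal.mul_mem_left _ _ hz₄) (Ideal.mul_mem_right _ _ hz₃)) hz₁
    · rw [Multiset.cons_add, mterm_cons, mterm_singleton]
      linear_combination (linForm a) * hδ

/-- Distinct similarity classes modulo `V`: if `c ∉ V` lies in `V + K a` then `V + K c = V + K a`.
[folklore] -/
theorem sup_span_eq_of_mem {V : Submodule K (Fin N → K)} {a c : Fin N → K} (hc : c ∉ V)
    (hca : c ∈ V ⊔ K ∙ a) : V ⊔ K ∙ c = V ⊔ K ∙ a := by
  apply le_antisymm
  · exact sup_le le_sup_left ((Submodule.span_singleton_le_iff_mem _ _).mpr hca)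
  · obtain ⟨v, hv, z, hz, hvz⟩ := Submodule.mem_sup.mp hca
    obtain ⟨μ, rfl⟩ := Submodule.mem_span_singleton.mp hz
    have hμ : μ ≠ 0 := by
      rintro rfl
      rw [zero_smul, add_zero] at hvz
      exact hc (hvz ▸ hv)
    refine sup_le le_sup_left ((Submodule.span_singleton_le_iff_mem _ _).mpr ?_)
    have hac : a = μ⁻¹ • (c - v) := by
      rw [← hvz, add_sub_cancel_left, smul_smul, inv_mul_cancel₀ hμ, one_smul]
    rw [hac]
    exact Submodule.smul_mem _ _ (sub_mem (Submodule.mem_sup_right (Submodule.mem_span_singleton_self _))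
      (Submodule.mem_sup_left hv))

/-- If `b ∉ V` then `V + K b ≠ V`. [folklore] -/
theorem sup_span_ne_of_not_mem {V : Submodule K (Fin N → K)} {b : Fin N → K} (hb : b ∉ V) :
    V ⊔ K ∙ b ≠ V := fun h =>
  hb (h ▸ Submodule.mem_sup_right (Submodule.mem_span_singleton_self b))

open scoped Classical in
/-- **Ideal Chinese remaindering over nodes** (SS10b; the step behind SS12 Theorem 6).  Partition
the forms of a term `T` into the forms lying in `V ⊇ radsp(I)` and the similarity classes modulo
`V` of the remaining ones (the *nodes* of `T` modulo `I`).  If `f ∈ ⟨I, v⟩` for every node `v`,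
then `f ∈ ⟨I, M(T)⟩`. [cite: SaxenaSeshadhri2012, Section 3.1 and Theorem 6] -/
theorem mem_formIdeal_insert_of_nodes {𝒢 : Set (Multiset (Fin N → K))} {V : Submodule K (Fin N → K)}
    (h𝒢 : ∀ S ∈ 𝒢, ∀ b ∈ S, b ∈ V) (T : Multiset (Fin N → K)) {f : MvPolynomial (Fin N) K}
    (h0 : f ∈ formIdeal (insert (T.filter (· ∈ V)) 𝒢))
    (h1 : ∀ b ∈ T, b ∉ V →
      f ∈ formIdeal (insert ((T.filter (· ∉ V)).filter (fun c => V ⊔ K ∙ c = V ⊔ K ∙ b)) 𝒢)) :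
    f ∈ formIdeal (insert T 𝒢) := by
  set T₁ := T.filter (· ∉ V) with hT₁
  set κ : (Fin N → K) → Submodule K (Fin N → K) := fun c => V ⊔ K ∙ c with hκ
  -- Step A: all the classes outside `V`, by induction over a finite set of classes.
  have stepA : ∀ 𝒦 : Finset (Submodule K (Fin N → K)),
      f ∈ formIdeal (insert (T₁.filter (fun c => κ c ∈ 𝒦)) 𝒢) := by
    intro 𝒦
    induction 𝒦 using Finset.induction_on with
    | empty =>
      have h0' : T₁.filter (fun c => κ c ∈ (∅ : Finset (Submodule K (Fin N → K)))) = 0 :=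
        Multiset.filter_eq_nil.mpr fun c _ => Finset.notMem_empty _
      rw [h0']
      have h1' : (1 : MvPolynomial (Fin N) K) ∈ formIdeal (insert (0 : Multiset (Fin N → K)) 𝒢) := by
        simpa using mterm_mem_formIdeal (Set.mem_insert (0 : Multiset (Fin N → K)) 𝒢)
      exact (Ideal.eq_top_of_isUnit_mem _ h1' isUnit_one).symm ▸ Submodule.mem_top
    | insert W 𝒦 hW ih =>
      have hsplit : T₁.filter (fun c => κ c ∈ insert W 𝒦) =
          T₁.filter (fun c => κ c ∈ 𝒦) + T₁.filter (fun c => κ c = W) := by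
        rw [Multiset.filter_add_filter]
        have hand : T₁.filter (fun c => κ c ∈ 𝒦 ∧ κ c = W) = 0 :=
          Multiset.filter_eq_nil.mpr fun c _ h => hW (h.2 ▸ h.1)
        rw [hand, add_zero]
        exact Multiset.filter_congr fun c _ => by simp [or_comm]
      rw [hsplit]
      by_cases hex : ∃ b ∈ T₁, κ b = W
      · obtain ⟨b, hb, hbW⟩ := hex
        have hbT : b ∈ T := Multiset.mem_of_mem_filter hb
        have hbV : b ∉ V := (Multiset.mem_filter.mp hb).2
        have hfw : f ∈ formIdeal (insert (T₁.filter (fun c => κ c = W)) 𝒢) := by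
          have := h1 b hbT hbV
          rwa [← hbW]
        refine mem_formIdeal_insert_add h𝒢 (fun a ha => (Multiset.mem_filter.mp
          (Multiset.mem_of_mem_filter ha)).2) (fun c hc a ha => ?_) ih hfw
        have hcW : κ c = W := (Multiset.mem_filter.mp hc).2
        have hcV : c ∉ V := (Multiset.mem_filter.mp (Multiset.mem_of_mem_filter hc)).2
        have ha𝒦 : κ a ∈ 𝒦 := (Multiset.mem_filter.mp ha).2
        intro hca
        have hκca : κ c = κ a := sup_span_eq_of_mem hcV hca
        rw [← hκca, hcW] at ha𝒦
        exact hW ha𝒦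
      · have hzero : T₁.filter (fun c => κ c = W) = 0 :=
          Multiset.filter_eq_nil.mpr fun c hc h => hex ⟨c, hc, h⟩
        rwa [hzero, add_zero]
  have hA : f ∈ formIdeal (insert T₁ 𝒢) := by
    have := stepA (T₁.map κ).toFinset
    rwa [Multiset.filter_eq_self.mpr] at this
    intro c hc
    exact Multiset.mem_toFinset.mpr (Multiset.mem_map_of_mem κ hc)
  -- Step B: the forms inside `V`.
  set T₀ := T.filter (· ∈ V) with hT₀
  have hT : T = T₀ + T₁ := (Multiset.filter_add_not (· ∈ V) T).symm
  obtain ⟨β, z, hz, rfl⟩ := mem_formIdeal_insert.mp hA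
  have h𝒢₀ : ∀ S ∈ insert T₀ 𝒢, ∀ b ∈ S, b ∈ V := by
    rintro S (rfl | hS) b hb
    · exact (Multiset.mem_filter.mp hb).2
    · exact h𝒢 S hS b hb
  have hβ : mterm T₁ * β ∈ formIdeal (insert T₀ 𝒢) := by
    have : mterm T₁ * β = β * mterm T₁ + z - z := by ring
    rw [this]
    exact sub_mem h0 (formIdeal_le_insert _ _ hz)
  have hβ' := cancel_mterm h𝒢₀ (fun c hc => (Multiset.mem_filter.mp hc).2) hβ
  obtain ⟨β', z', hz', rfl⟩ := mem_formIdeal_insert.mp hβ'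
  rw [mem_formIdeal_insert]
  refine ⟨β', z' * mterm T₁ + z, add_mem (Ideal.mul_mem_right _ _ hz') hz, ?_⟩
  rw [hT, mterm_add]
  ring

/-- The node step of the certificate (SS12 Theorem 6 after SS10b Theorem 25): if
`f ∉ ⟨𝒢, M(T)⟩` then some node `S` of `T` — either the forms of `T` inside `V`, or a similarity
class modulo `V` of forms outside `V` — still has `f ∉ ⟨𝒢, M(S)⟩`; adding it to the ideal raises
the rank of the radical span by at most one. [cite: SaxenaSeshadhri2012, Theorem 6] -/
theorem exists_node {𝒢 : Set (Multiset (Fin N → K))} {V : Submodule K (Fin N → K)}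
    (h𝒢 : ∀ S ∈ 𝒢, ∀ b ∈ S, b ∈ V) (T : Multiset (Fin N → K)) {f : MvPolynomial (Fin N) K}
    (hf : f ∉ formIdeal (insert T 𝒢)) :
    ∃ S ≤ T, f ∉ formIdeal (insert S 𝒢) ∧
      ((∀ c ∈ S, c ∈ V) ∨ ∃ b ∈ T, b ∉ V ∧ ∀ c ∈ S, c ∈ V ⊔ K ∙ b) := by
  classical
  by_cases h0 : f ∈ formIdeal (insert (T.filter (· ∈ V)) 𝒢)
  · by_contra hcon
    refine hf (mem_formIdeal_insert_of_nodes h𝒢 T h0 fun b hb hbV => ?_)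
    by_contra h1
    refine hcon ⟨_, (Multiset.filter_le _ _).trans (Multiset.filter_le _ _), h1,
      Or.inr ⟨b, hb, hbV, fun c hc => ?_⟩⟩
    have hcb : V ⊔ K ∙ c = V ⊔ K ∙ b := (Multiset.mem_filter.mp hc).2
    exact hcb ▸ Submodule.mem_sup_right (Submodule.mem_span_singleton_self c)
  · exact ⟨_, Multiset.filter_le _ _, h0, Or.inl fun c hc => (Multiset.mem_filter.mp hc).2⟩

/-! ## Homogeneity -/

/-- The degree-`d` component of `a · p` for `p` homogeneous of degree `d` is `a(0) · p`.
[folklore] -/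
theorem homogeneousComponent_mul_of_isHomogeneous {d : ℕ} (a p : MvPolynomial (Fin N) K)
    (hp : p.IsHomogeneous d) : homogeneousComponent d (a * p) = a.coeff 0 • p := by
  conv_lhs => rw [← sum_homogeneousComponent a, Finset.sum_mul, map_sum]
  rw [Finset.sum_eq_single 0]
  · rw [homogeneousComponent_of_mem ((homogeneousComponent_isHomogeneous 0 a).mul hp), zero_add,
      if_pos rfl, homogeneousComponent_zero, smul_eq_C_mul]
  · intro j _ hj
    rw [homogeneousComponent_of_mem ((homogeneousComponent_isHomogeneous j a).mul hp), if_neg]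
    omega
  · intro h
    exact absurd (Finset.mem_range.mpr (Nat.succ_pos _)) h

/-- **The base case of the certificate (SS12 Theorem 6, `i = 0`).** If a form `f` of degree
`|T|` lies in `⟨I, M(T)⟩` for a homogeneous ideal `I = ⟨𝒢⟩`, then `f ≡ α M(T) (mod I)` for a
scalar `α`. [cite: SaxenaSeshadhri2012, Theorem 6] -/
theorem exists_sub_smul_mem {𝒢 : Set (Multiset (Fin N → K))} {T : Multiset (Fin N → K)}
    {f : MvPolynomial (Fin N) K} (hf : f.IsHomogeneous (Multiset.card T))
    (h : f ∈ formIdeal (insert T 𝒢)) : ∃ α : K, f - α • mterm T ∈ formIdeal 𝒢 := by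
  letI : GradedAlgebra (homogeneousSubmodule (Fin N) K) := MvPolynomial.gradedAlgebra
  have hI : (formIdeal 𝒢).IsHomogeneous (homogeneousSubmodule (Fin N) K) :=
    Ideal.homogeneous_span _ _ (by
      rintro _ ⟨S, _, rfl⟩
      exact ⟨Multiset.card S, isHomogeneous_mterm S⟩)
  obtain ⟨a, z, hz, rfl⟩ := mem_formIdeal_insert.mp h
  refine ⟨a.coeff 0, ?_⟩
  have hhom := homogeneousComponent_eq_self hf
  rw [map_add, homogeneousComponent_mul_of_isHomogeneous a _ (isHomogeneous_mterm T)] at hhom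
  have h2 : homogeneousComponent (Multiset.card T) z ∈ formIdeal 𝒢 :=
    homogeneousComponent_mem_of_mem hI hz _
  rw [← hhom, add_sub_cancel_left]
  exact h2

/-! ## The certificate induction (SS12 Theorem 6 + Lemma 11 + Claim 12, merged) -/

/-- A sum of terms with `d` forms each is homogeneous of degree `d`. [folklore] -/
theorem isHomogeneous_sum_mterm {m d : ℕ} (T : Fin m → Multiset (Fin N → K))
    (hTd : ∀ i, Multiset.card (T i) = d) : (∑ i, mterm (T i)).IsHomogeneous d :=
  IsHomogeneous.sum _ _ _ fun i _ => hTd i ▸ isHomogeneous_mterm (T i)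

/-- **Saxena–Seshadhri 2012, the variable-reduction induction** (Theorem 6 = SS10b Theorem 25,
merged with Lemma 11 and Claim 12).  Let `Φ` act on linear forms through `φ`, and let `φ` be
injective on the span of any `≤ k` vectors of `L`.  Let `I = ⟨𝒢⟩` be generated by products of
forms in `V = span(s_V)` with `s_V ⊆ L`, and let `C = Σ_{i<m} M(T_i)` be a sum of `m` terms with
`d` forms each, all forms in `L`, with `|s_V| + m ≤ k`.  If `C ∉ I` then `Φ(C) ∉ Φ(I)`.
[cite: SaxenaSeshadhri2012, Theorem 6, Lemma 11 and Claim 12] -/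
theorem map_sum_mterm_not_mem (Φ : MvPolynomial (Fin N) K →ₐ[K] MvPolynomial (Fin M) K)
    (φ : (Fin N → K) →ₗ[K] (Fin M → K)) (hΦ : ∀ v, Φ (linForm v) = linForm (φ v))
    (L : Set (Fin N → K)) (k : ℕ)
    (hk : ∀ s : Finset (Fin N → K), ↑s ⊆ L → s.card ≤ k →
      ∀ v ∈ Submodule.span K (s : Set (Fin N → K)), φ v = 0 → v = 0)
    (d : ℕ) :
    ∀ (m : ℕ) (𝒢 : Set (Multiset (Fin N → K))) (sV : Finset (Fin N → K))
      (T : Fin m → Multiset (Fin N → K)),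
      ↑sV ⊆ L → sV.card + m ≤ k →
      (∀ S ∈ 𝒢, ∀ b ∈ S, b ∈ Submodule.span K (sV : Set (Fin N → K))) →
      (∀ i, ∀ b ∈ T i, b ∈ L) → (∀ i, Multiset.card (T i) = d) →
      (∑ i, mterm (T i)) ∉ formIdeal 𝒢 → Φ (∑ i, mterm (T i)) ∉ (formIdeal 𝒢).map Φ := by
  classical
  intro m
  induction m with
  | zero =>
    intro 𝒢 sV T _ _ _ _ _ hC
    exact absurd (by simp) hC
  | succ m ih =>
    intro 𝒢 sV T hsV hcard h𝒢 hTL hTd hC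
    set V : Submodule K (Fin N → K) := Submodule.span K (sV : Set (Fin N → K)) with hV
    have hsum : ∑ i, mterm (T i) = mterm (T 0) + ∑ i : Fin m, mterm (T i.succ) :=
      Fin.sum_univ_succ _
    -- injectivity of `φ` on `V` and on `V + K c` for `c ∈ L`
    have hinjV : ∀ v ∈ V, φ v = 0 → v = 0 := hk sV hsV (by omega)
    have hinjVc : ∀ c ∈ L, c ∉ V → φ c ∉ V.map φ := by
      intro c hcL hcV hφc
      obtain ⟨v, hv, hφv⟩ := Submodule.mem_map.mp hφc
      have hs : ↑(insert c sV) ⊆ L := by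
        rw [Finset.coe_insert]
        exact Set.insert_subset hcL hsV
      have hcv : c - v = 0 := by
        refine hk (insert c sV) hs ((Finset.card_insert_le _ _).trans (by omega)) (c - v) ?_
          (by rw [map_sub, hφv, sub_self])
        rw [Finset.coe_insert, Submodule.span_insert]
        exact sub_mem (Submodule.mem_sup_left (Submodule.mem_span_singleton_self c))
          (Submodule.mem_sup_right hv)
      exact hcV (sub_eq_zero.mp hcv ▸ hv)
    by_cases hcase : (∑ i, mterm (T i)) ∈ formIdeal (insert (T 0) 𝒢)
    · -- Case 1: `C ≡ α M(T₀) (mod I)`; transfer the single term `M(T₀)`.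
      obtain ⟨α, hα⟩ := exists_sub_smul_mem ((hTd 0).symm ▸ isHomogeneous_sum_mterm T hTd) hcase
      intro hΦC
      apply hC
      -- `Φ(M(T₀)) ∈ Φ(I)`
      have hα0 : α ≠ 0 := by
        rintro rfl
        rw [zero_smul, sub_zero] at hα
        exact hC hα
      have hΦT : Φ (mterm (T 0)) ∈ (formIdeal 𝒢).map Φ := by
        have h1 : Φ (α • mterm (T 0)) ∈ (formIdeal 𝒢).map Φ := by
          have : α • mterm (T 0) = ∑ i, mterm (T i) - (∑ i, mterm (T i) - α • mterm (T 0)) := by ring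
          rw [this, map_sub]
          exact sub_mem hΦC (Ideal.mem_map_of_mem _ hα)
        rw [map_smul] at h1
        have h2 := Ideal.mul_mem_left _ (C α⁻¹) h1
        rwa [smul_eq_C_mul, ← mul_assoc, ← C_mul, inv_mul_cancel₀ hα0, C_1, one_mul] at h2
      -- split `T₀` into the forms inside / outside `V`
      set S₀ := (T 0).filter (· ∈ V) with hS₀
      set S₁ := (T 0).filter (· ∉ V) with hS₁
      have hT0 : T 0 = S₀ + S₁ := (Multiset.filter_add_not (· ∈ V) (T 0)).symm
      have hΦS₀ : Φ (mterm S₀) ∈ (formIdeal 𝒢).map Φ := by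
        rw [hT0, mterm_add, map_mul, map_mterm Φ φ hΦ S₁, mul_comm] at hΦT
        rw [map_formIdeal Φ φ hΦ] at hΦT ⊢
        refine cancel_mterm (V := V.map φ) ?_ ?_ hΦT
        · rintro _ ⟨S, hS, rfl⟩ b hb
          obtain ⟨b', hb', rfl⟩ := Multiset.mem_map.mp hb
          exact Submodule.mem_map_of_mem (h𝒢 S hS b' hb')
        · intro c hc
          obtain ⟨c', hc', rfl⟩ := Multiset.mem_map.mp hc
          exact hinjVc c' (hTL 0 c' (Multiset.mem_of_mem_filter hc')) (Multiset.mem_filter.mp hc').2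
      have hS₀I : mterm S₀ ∈ formIdeal 𝒢 :=
        mterm_mem_of_map_mem Φ φ hΦ h𝒢 hinjV (fun b hb => (Multiset.mem_filter.mp hb).2) hΦS₀
      have hT0I : α • mterm (T 0) ∈ formIdeal 𝒢 := by
        rw [hT0, mterm_add, smul_eq_C_mul, ← mul_assoc, mul_comm _ (mterm S₁)]
        exact Ideal.mul_mem_left _ _ (Ideal.mul_mem_left _ _ hS₀I)
      have : ∑ i, mterm (T i) = (∑ i, mterm (T i) - α • mterm (T 0)) + α • mterm (T 0) := by ring
      rw [this]
      exact add_mem hα hT0I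
    · -- Case 2: descend to a node of `T₀` and drop the first term.
      obtain ⟨S, hST, hCS, hnode⟩ := exists_node h𝒢 (T 0) hcase
      have hT0S : mterm (T 0) ∈ formIdeal (insert S 𝒢) := by
        simpa using mul_mterm_mem_formIdeal_insert (𝒢 := 𝒢) hST 1
      have hC' : (∑ i : Fin m, mterm (T i.succ)) ∉ formIdeal (insert S 𝒢) := by
        intro h'
        apply hCS
        rw [hsum]
        exact add_mem hT0S h'
      -- it suffices to treat the larger ideal `⟨𝒢, M(S)⟩` and the shorter sum
      suffices hsuff : Φ (∑ i : Fin m, mterm (T i.succ)) ∉ (formIdeal (insert S 𝒢)).map Φ by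
        intro hΦC
        apply hsuff
        have heq : Φ (∑ i : Fin m, mterm (T i.succ)) = Φ (∑ i, mterm (T i)) - Φ (mterm (T 0)) := by
          rw [hsum, map_add]
          ring
        rw [heq]
        exact sub_mem (Ideal.map_mono (formIdeal_le_insert _ _) hΦC) (Ideal.mem_map_of_mem _ hT0S)
      rcases hnode with hSV | ⟨b, hb, hbV, hSb⟩
      · refine ih (insert S 𝒢) sV (fun i => T i.succ) hsV (by omega) ?_ (fun i c hc => hTL _ c hc)
          (fun i => hTd _) hC'
        rintro S' (rfl | hS') c hc
        · exact hSV c hc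
        · exact h𝒢 S' hS' c hc
      · have hbL : b ∈ L := hTL 0 b hb
        refine ih (insert S 𝒢) (insert b sV) (fun i => T i.succ) ?_ ?_ ?_ (fun i c hc => hTL _ c hc)
          (fun i => hTd _) hC'
        · rw [Finset.coe_insert]
          exact Set.insert_subset hbL hsV
        · have hc := Finset.card_insert_le b sV
          omega
        · have hspan : Submodule.span K (↑(insert b sV) : Set (Fin N → K)) = V ⊔ K ∙ b := by
            rw [Finset.coe_insert, Submodule.span_insert, sup_comm]
          rintro S' (rfl | hS') c hc
          · rw [hspan]
            exact hSb c hc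
          · rw [hspan]
            exact Submodule.mem_sup_left (h𝒢 S' hS' c hc)

/-- **Saxena–Seshadhri 2012, Lemma 11 (abstract form): a rank-`k`-preserving homomorphism keeps
a nonzero `ΣΠΣ(k, d)` circuit nonzero.**  If `Φ` acts on linear forms through `φ`, `φ` is
injective on the span of any `≤ k` of the forms of `C = Σ_{i<k} M(T_i)` (`|T_i| = d`), and
`C ≠ 0`, then `Φ(C) ≠ 0`. [cite: SaxenaSeshadhri2012, Lemma 11] -/
theorem map_sum_mterm_ne_zero (Φ : MvPolynomial (Fin N) K →ₐ[K] MvPolynomial (Fin M) K)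
    (φ : (Fin N → K) →ₗ[K] (Fin M → K)) (hΦ : ∀ v, Φ (linForm v) = linForm (φ v))
    (L : Set (Fin N → K)) (k d : ℕ)
    (hk : ∀ s : Finset (Fin N → K), ↑s ⊆ L → s.card ≤ k →
      ∀ v ∈ Submodule.span K (s : Set (Fin N → K)), φ v = 0 → v = 0)
    (T : Fin k → Multiset (Fin N → K)) (hTL : ∀ i, ∀ b ∈ T i, b ∈ L)
    (hTd : ∀ i, Multiset.card (T i) = d) (hC : ∑ i, mterm (T i) ≠ 0) :
    Φ (∑ i, mterm (T i)) ≠ 0 := by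
  have h := map_sum_mterm_not_mem Φ φ hΦ L k hk d k ∅ ∅ T (by simp) (by simp) (by simp) hTL hTd
  have h0 : formIdeal (∅ : Set (Multiset (Fin N → K))) = ⊥ := by simp [formIdeal]
  rw [h0, Ideal.map_bot] at h
  simpa using h (by simpa using hC)

end Ideals

section Assembly

open MvPolynomial

open Literature.RingTheory.MvPolynomial (linForm linForm_apply linForm_single isHomogeneous_linForm)

variable {K : Type*} [Field K]

/-! ## Affine forms and (de)homogenisation -/

/-- An exponent vector of degree `≤ 1` is `0` or a unit vector. [folklore] -/
theorem finsupp_eq_zero_or_single_of_degree_le_one {σ : Type*} (e : σ →₀ ℕ) (h : e.degree ≤ 1) :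
    e = 0 ∨ ∃ i, e = Finsupp.single i 1 := by
  classical
  have hcard : Multiset.card (Finsupp.toMultiset e) ≤ 1 := by
    rw [Finsupp.card_toMultiset]
    simpa [Finsupp.degree, Finsupp.sum] using h
  rcases Nat.le_one_iff_eq_zero_or_eq_one.mp hcard with h0 | h1
  · left
    rw [← Finsupp.toMultiset_toFinsupp e, Multiset.card_eq_zero.mp h0, map_zero]
  · right
    obtain ⟨i, hi⟩ := Multiset.card_eq_one.mp h1
    refine ⟨i, ?_⟩
    rw [← Finsupp.toMultiset_toFinsupp e, hi, Multiset.toFinsupp_singleton]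

/-- A polynomial of total degree `≤ 1` is an affine form `q(0) + Σ_i q_i X_i`. [folklore] -/
theorem eq_C_add_sum_of_totalDegree_le_one {n : ℕ} (q : MvPolynomial (Fin n) K)
    (hq : q.totalDegree ≤ 1) :
    q = C (q.coeff 0) + ∑ i, q.coeff (Finsupp.single i 1) • X i := by
  classical
  ext e
  simp only [coeff_add, coeff_C, coeff_sum, coeff_smul, coeff_X, smul_eq_mul, mul_ite, mul_one,
    mul_zero]
  by_cases hdeg : e.degree ≤ 1
  · rcases finsupp_eq_zero_or_single_of_degree_le_one e hdeg with rfl | ⟨i, rfl⟩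
    · simp
    · rw [if_neg (Ne.symm (Finsupp.single_ne_zero.mpr one_ne_zero)), zero_add, Finset.sum_eq_single i]
      · rw [if_pos rfl]
      · intro j _ hj
        rw [if_neg]
        exact fun h => hj (Finsupp.single_left_injective one_ne_zero h)
      · intro h
        exact absurd (Finset.mem_univ i) h
  · push Not at hdeg
    have hcoeff : q.coeff e = 0 := by
      refine coeff_eq_zero_of_totalDegree_lt (hq.trans_lt ?_)
      simpa [Finsupp.degree] using hdeg
    rw [hcoeff, if_neg, zero_add, Finset.sum_eq_zero]
    · intro i _
      rw [if_neg]
      rintro rfl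
      simp at hdeg
    · rintro rfl
      simp at hdeg

/-- The coefficient vector `(q(0), q_1, …, q_n) ∈ K^{n+1}` of an affine form (index `0` is the
homogenising coordinate). [folklore] -/
theorem aeval_cons_one_linForm_vec {n : ℕ} (q : MvPolynomial (Fin n) K) (hq : q.totalDegree ≤ 1) :
    aeval (Fin.cons 1 X : Fin (n + 1) → MvPolynomial (Fin n) K)
      (linForm (Fin.cons (q.coeff 0) fun i => q.coeff (Finsupp.single i 1) : Fin (n + 1) → K)) = q := by
  rw [aeval_linForm, Fin.sum_univ_succ]
  simp only [Fin.cons_zero, Fin.cons_succ]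
  conv_rhs => rw [eq_C_add_sum_of_totalDegree_le_one q hq]
  rw [smul_eq_C_mul, mul_one]

/-- The degree of an exponent vector on `Fin (k+1)` splits off the `0`-th coordinate. [folklore] -/
theorem finsupp_degree_eq_add_tail {k : ℕ} (e : Fin (k + 1) →₀ ℕ) :
    e.degree = e 0 + (Finsupp.tail e).degree := by
  classical
  rw [Finsupp.degree_eq_sum, Finsupp.degree_eq_sum, Fin.sum_univ_succ]
  simp [Finsupp.tail_apply]

/-- Dehomogenisation `y_0 ↦ 1` sends the monomial `y^e` to `y^{tail e}`. [folklore] -/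
theorem aeval_cons_one_monomial {k : ℕ} (e : Fin (k + 1) →₀ ℕ) (c : K) :
    aeval (Fin.cons 1 X : Fin (k + 1) → MvPolynomial (Fin k) K) (monomial e c) =
      monomial (Finsupp.tail e) c := by
  classical
  rw [aeval_monomial, monomial_eq, Finsupp.prod_fintype _ _ (fun i => by simp),
    Finsupp.prod_fintype _ _ (fun i => by simp), Fin.prod_univ_succ]
  simp [Finsupp.tail_apply]

/-- **Dehomogenisation is injective on forms**: if `Q(y_0, …, y_k)` is homogeneous and
`Q(1, y_1, …, y_k) = 0` then `Q = 0`. [folklore] -/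
theorem eq_zero_of_isHomogeneous_of_aeval_cons_one {k d : ℕ} (Q : MvPolynomial (Fin (k + 1)) K)
    (hQ : Q.IsHomogeneous d)
    (h : aeval (Fin.cons 1 X : Fin (k + 1) → MvPolynomial (Fin k) K) Q = 0) : Q = 0 := by
  classical
  by_contra hQ0
  obtain ⟨e₀, he₀⟩ := ne_zero_iff.mp hQ0
  have hsum : aeval (Fin.cons 1 X : Fin (k + 1) → MvPolynomial (Fin k) K) Q =
      ∑ e ∈ Q.support, monomial (Finsupp.tail e) (Q.coeff e) := by
    conv_lhs => rw [Q.as_sum, map_sum]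
    exact Finset.sum_congr rfl fun e _ => aeval_cons_one_monomial e _
  have hdegQ : ∀ e ∈ Q.support, e.degree = d := fun e he => by
    have := hQ (mem_support_iff.mp he)
    rw [Finsupp.degree_eq_weight_one]
    exact this
  have hcoeff : (aeval (Fin.cons 1 X : Fin (k + 1) → MvPolynomial (Fin k) K) Q).coeff
      (Finsupp.tail e₀) = Q.coeff e₀ := by
    rw [hsum, coeff_sum, Finset.sum_eq_single e₀]
    · rw [coeff_monomial, if_pos rfl]
    · intro e he hne
      rw [coeff_monomial, if_neg]
      intro htail
      apply hne
      have h0 : e 0 = e₀ 0 := by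
        have h1 := finsupp_degree_eq_add_tail e
        have h2 := finsupp_degree_eq_add_tail e₀
        rw [hdegQ e he, htail] at h1
        rw [hdegQ e₀ (mem_support_iff.mpr he₀)] at h2
        omega
      rw [← Finsupp.cons_tail e, ← Finsupp.cons_tail e₀, htail, h0]
    · intro he₀'
      exact absurd (mem_support_iff.mpr he₀) he₀'
  rw [h, coeff_zero] at hcoeff
  exact he₀ hcoeff.symm

/-! ## Degree in `t` of the generic substitution -/

section TDegree

variable {F : Type*} [Field F]

/-- Products: the `t`-degree of coefficients is subadditive. [folklore] -/
theorem natDegree_coeff_mul_le {k : ℕ} {P Q : MvPolynomial (Fin k) (Polynomial F)} {D D' : ℕ}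
    (hP : ∀ e, (P.coeff e).natDegree ≤ D) (hQ : ∀ e, (Q.coeff e).natDegree ≤ D')
    (e : Fin k →₀ ℕ) : ((P * Q).coeff e).natDegree ≤ D + D' := by
  rw [coeff_mul]
  refine Polynomial.natDegree_sum_le_of_forall_le _ _ fun x _ => ?_
  exact Polynomial.natDegree_mul_le.trans (add_le_add (hP _) (hQ _))

/-- Finite products. [folklore] -/
theorem natDegree_coeff_prod_le {k : ℕ} {ι : Type*} [DecidableEq ι] (s : Finset ι)
    (P : ι → MvPolynomial (Fin k) (Polynomial F)) (D : ι → ℕ)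
    (h : ∀ i ∈ s, ∀ e, ((P i).coeff e).natDegree ≤ D i) (e : Fin k →₀ ℕ) :
    ((∏ i ∈ s, P i).coeff e).natDegree ≤ ∑ i ∈ s, D i := by
  induction s using Finset.induction_on generalizing e with
  | empty =>
    rw [Finset.prod_empty, Finset.sum_empty, coeff_one]
    split_ifs <;> simp
  | insert a s ha ih =>
    rw [Finset.prod_insert ha, Finset.sum_insert ha]
    exact natDegree_coeff_mul_le (h a (Finset.mem_insert_self a s))
      (fun e => ih (fun i hi => h i (Finset.mem_insert_of_mem hi)) e) e

/-- Powers. [folklore] -/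
theorem natDegree_coeff_pow_le {k : ℕ} {P : MvPolynomial (Fin k) (Polynomial F)} {D : ℕ}
    (hP : ∀ e, (P.coeff e).natDegree ≤ D) (m : ℕ) (e : Fin k →₀ ℕ) :
    ((P ^ m).coeff e).natDegree ≤ m * D := by
  classical
  have := natDegree_coeff_prod_le (Finset.range m) (fun _ => P) (fun _ => D) (fun _ _ => hP) e
  rwa [Finset.prod_const, Finset.card_range, Finset.sum_const, Finset.card_range, smul_eq_mul] at this

/-- **The `t`-degree of the generic substitution**: if `f` has total degree `≤ d` and every
coefficient of every `g_i` has degree `≤ D` in `t`, then every coefficient of `f(g)` has degree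
`≤ d D`. [folklore] -/
theorem natDegree_coeff_aeval_le {n k d D : ℕ} (f : MvPolynomial (Fin n) F) (hf : f.totalDegree ≤ d)
    (g : Fin n → MvPolynomial (Fin k) (Polynomial F)) (hg : ∀ i e, ((g i).coeff e).natDegree ≤ D)
    (e : Fin k →₀ ℕ) : ((aeval g f).coeff e).natDegree ≤ d * D := by
  classical
  rw [MvPolynomial.aeval_def, MvPolynomial.eval₂_eq, coeff_sum]
  refine Polynomial.natDegree_sum_le_of_forall_le _ _ fun m hm => ?_
  have hC : ∀ e', ((algebraMap F (MvPolynomial (Fin k) (Polynomial F)) (f.coeff m)).coeff e').natDegree ≤ 0 := by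
    intro e'
    rw [MvPolynomial.algebraMap_apply, coeff_C, Polynomial.algebraMap_eq]
    split_ifs
    · exact (Polynomial.natDegree_C _).le
    · simp
  have hprod : ∀ e', ((m.support.prod fun i => g i ^ m i).coeff e').natDegree ≤ ∑ i ∈ m.support, m i * D :=
    natDegree_coeff_prod_le m.support (fun i => g i ^ m i) (fun i => m i * D)
      (fun i _ e' => natDegree_coeff_pow_le (hg i) (m i) e')
  refine (natDegree_coeff_mul_le hC hprod e).trans ?_
  rw [zero_add, ← Finset.sum_mul]
  exact Nat.mul_le_mul_right D ((le_totalDegree hm).trans hf)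

end TDegree

/-! ## Nonvanishing of the generic substitution -/

section Main

variable {F : Type*} [Field F]

/-- The total degree does not increase under extension of scalars. [folklore] -/
theorem totalDegree_map_le' {n : ℕ} {S : Type*} [CommSemiring S] (f : F →+* S) (q : MvPolynomial (Fin n) F) :
    (MvPolynomial.map f q).totalDegree ≤ q.totalDegree :=
  Finset.sup_mono (support_map_subset f q)

/-- **Saxena–Seshadhri 2012, Lemma 11 with a transcendental `β`.** For a nonzero affine
`ΣΠΣ(k, d, n)` circuit `C = Σ_i Π_j ℓ_{ij}` over `F`, the generic Vandermonde substitution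
`x_i ↦ Σ_j t^{(i+1)(j+1)} y_j` (`t` an indeterminate) gives a nonzero element of `F[t][y]`.
Proof: homogenise with `x_0 ↦ y_0`, extend scalars to `F(t)`, apply `map_sum_mterm_ne_zero` with
the rank lemma `eq_zero_of_vandermonde_eq_zero`, and dehomogenise.
[cite: SaxenaSeshadhri2012, Lemma 11] -/
theorem aeval_vandermonde_generic_ne_zero {k d n : ℕ} (dd : Fin k → ℕ) (hdd : ∀ i, dd i ≤ d)
    (ℓ : (i : Fin k) → Fin (dd i) → MvPolynomial (Fin n) F)
    (hℓ : ∀ i j, (ℓ i j).totalDegree ≤ 1) (hC : (∑ i, ∏ j, ℓ i j) ≠ 0) :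
    aeval (fun i : Fin n => ∑ j : Fin k,
      C (Polynomial.X ^ ((i.1 + 1) * (j.1 + 1)) : Polynomial F) * X j) (∑ i, ∏ j, ℓ i j) ≠ 0 := by
  classical
  -- the transcendental extension `K = F(t)`
  let K := RatFunc F
  let ι : F →+* K := algebraMap F K
  let t : K := algebraMap (Polynomial F) K Polynomial.X
  have hinj : Function.Injective (algebraMap (Polynomial F) K) := RatFunc.algebraMap_injective F
  intro hP
  -- Step 1: over `K`, `Ψ_t(C_K) = 0`.
  let ΨK : MvPolynomial (Fin n) K →ₐ[K] MvPolynomial (Fin k) K :=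
    aeval fun i : Fin n => ∑ j : Fin k, C (t ^ ((i.1 + 1) * (j.1 + 1))) * X j
  have hΨK : ΨK (MvPolynomial.map ι (∑ i, ∏ j, ℓ i j)) = 0 := by
    have hcomp : (ΨK : MvPolynomial (Fin n) K →+* MvPolynomial (Fin k) K).comp (MvPolynomial.map ι) =
        (MvPolynomial.map (algebraMap (Polynomial F) K)).comp
          ↑(aeval (R := F) fun i : Fin n => ∑ j : Fin k,
            C (Polynomial.X ^ ((i.1 + 1) * (j.1 + 1)) : Polynomial F) * X j) := by
      refine MvPolynomial.ringHom_ext (fun c => ?_) (fun i => ?_)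
      · simp [ΨK, ι, IsScalarTower.algebraMap_apply F (Polynomial F) K]
      · simp [ΨK, t, map_sum]
    have h1 := RingHom.congr_fun hcomp (∑ i, ∏ j, ℓ i j)
    simp only [RingHom.coe_comp, Function.comp_apply, RingHom.coe_coe] at h1
    rw [h1, hP, map_zero]
  -- Step 2: homogenise (coordinate `0` of `K^{n+1}` carries the constants).
  let vec : MvPolynomial (Fin n) K → (Fin (n + 1) → K) := fun q =>
    Fin.cons (q.coeff 0) fun i => q.coeff (Finsupp.single i 1)
  let e₀ : Fin (n + 1) → K := Pi.single 0 1
  let T : Fin k → Multiset (Fin (n + 1) → K) := fun i =>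
    (Finset.univ.val.map fun j : Fin (dd i) => vec (MvPolynomial.map ι (ℓ i j))) +
      Multiset.replicate (d - dd i) e₀
  let D : MvPolynomial (Fin (n + 1)) K →ₐ[K] MvPolynomial (Fin n) K := aeval (Fin.cons 1 X)
  have hDe₀ : D (linForm e₀) = 1 := by
    simp [D, e₀, linForm_single]
  have hDT : ∀ i, D (mterm (T i)) = ∏ j, MvPolynomial.map ι (ℓ i j) := by
    intro i
    show D (mterm (_ + _)) = _
    rw [mterm_add, map_mul, mterm_univ_map, mterm_replicate, map_prod, map_pow, hDe₀, one_pow, mul_one]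
    exact Finset.prod_congr rfl fun j _ =>
      aeval_cons_one_linForm_vec _ ((totalDegree_map_le' ι _).trans (hℓ i j))
  have hCh : (∑ i, mterm (T i)) ≠ 0 := by
    intro h0
    apply hC
    apply MvPolynomial.map_injective ι ι.injective
    rw [map_zero, map_sum, ← (map_sum D _ _).symm.trans (by rw [h0, map_zero] : D (∑ i, mterm (T i)) = 0)]
    exact Finset.sum_congr rfl fun i _ => by rw [map_prod, hDT]
  -- Step 3: the homogenised Vandermonde map `Φ` on `K[x_0, …, x_n]`.
  let φ : (Fin (n + 1) → K) →ₗ[K] (Fin (k + 1) → K) :=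
    { toFun := fun v => Fin.cons (v 0) fun j : Fin k => ∑ i : Fin n, v i.succ * t ^ ((i.1 + 1) * (j.1 + 1))
      map_add' := fun v w => by
        funext j
        refine Fin.cases ?_ (fun j => ?_) j
        · simp
        · simp [Finset.sum_add_distrib, add_mul]
      map_smul' := fun c v => by
        funext j
        refine Fin.cases ?_ (fun j => ?_) j
        · simp
        · simp only [Fin.cons_succ, Pi.smul_apply, smul_eq_mul, RingHom.id_apply]
          rw [Finset.mul_sum]
          exact Finset.sum_congr rfl fun i _ => by ring }
  have hφ0 : ∀ v, φ v 0 = v 0 := fun v => by simp [φ]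
  have hφs : ∀ v (j : Fin k), φ v j.succ = ∑ i : Fin n, v i.succ * t ^ ((i.1 + 1) * (j.1 + 1)) :=
    fun v j => by simp [φ]
  let Φ : MvPolynomial (Fin (n + 1)) K →ₐ[K] MvPolynomial (Fin (k + 1)) K :=
    aeval fun i => linForm (φ (Pi.single i 1))
  have hΦ : ∀ v, Φ (linForm v) = linForm (φ v) := fun v => aeval_linForm_linForm φ v
  -- Step 4: the forms are `F`-rational, and `φ` is injective on spans of `≤ k` rational vectors.
  let ιv : (Fin (n + 1) → F) → (Fin (n + 1) → K) := fun w i => ι (w i)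
  let L : Set (Fin (n + 1) → K) := Set.range ιv
  have hιv_inj : Function.Injective ιv := fun w w' h => funext fun i => ι.injective (congr_fun h i)
  have hvecL : ∀ q : MvPolynomial (Fin n) F, vec (MvPolynomial.map ι q) ∈ L := fun q =>
    ⟨Fin.cons (q.coeff 0) fun i => q.coeff (Finsupp.single i 1), by
      funext i
      refine Fin.cases ?_ (fun i => ?_) i
      · simp [ιv, vec, coeff_map]
      · simp [ιv, vec, coeff_map]⟩
  have he₀L : e₀ ∈ L := ⟨Pi.single 0 1, by
    funext i
    by_cases hi : i = 0
    · subst hi; simp [ιv, e₀]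
    · simp [ιv, e₀, hi]⟩
  have hTL : ∀ i, ∀ b ∈ T i, b ∈ L := by
    intro i b hb
    rcases Multiset.mem_add.mp hb with hb | hb
    · obtain ⟨j, _, rfl⟩ := Multiset.mem_map.mp hb
      exact hvecL _
    · rw [Multiset.eq_of_mem_replicate hb]
      exact he₀L
  have hTd : ∀ i, Multiset.card (T i) = d := fun i => by
    simp [T, Nat.add_sub_cancel' (hdd i)]
  have hk : ∀ s : Finset (Fin (n + 1) → K), ↑s ⊆ L → s.card ≤ k →
      ∀ v ∈ Submodule.span K (s : Set (Fin (n + 1) → K)), φ v = 0 → v = 0 := by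
    intro s hsL hsk v hv hφv
    obtain ⟨sF, -, hsF⟩ := Finset.subset_set_image_iff.mp
      (show (↑s : Set (Fin (n + 1) → K)) ⊆ ιv '' Set.univ by rwa [Set.image_univ])
    have hcard : sF.card ≤ k := by
      rw [← Finset.card_image_of_injective sF hιv_inj, hsF]
      exact hsk
    have hv0 : v 0 = 0 := by simpa [hφ0] using congr_fun hφv 0
    let tl : (Fin (n + 1) → K) →ₗ[K] (Fin n → K) := LinearMap.funLeft K K Fin.succ
    have htail : tl v ∈ Submodule.span K
        ((fun (w : Fin n → F) (i : Fin n) => ι (w i)) '' ↑(sF.image fun w => Fin.tail w)) := by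
      have h1 : tl v ∈ (Submodule.span K (s : Set (Fin (n + 1) → K))).map tl :=
        Submodule.mem_map_of_mem hv
      rw [Submodule.map_span] at h1
      refine (Submodule.span_mono ?_) h1
      rintro _ ⟨x, hx, rfl⟩
      rw [← hsF, Finset.coe_image] at hx
      obtain ⟨w, hw, rfl⟩ := hx
      refine ⟨Fin.tail w, ?_, rfl⟩
      rw [Finset.coe_image]
      exact ⟨w, hw, rfl⟩
    have htl0 : tl v = 0 := by
      refine eq_zero_of_vandermonde_eq_zero (K := K) hinj (sF.image fun w => Fin.tail w)
        (Finset.card_image_le.trans hcard) (tl v) htail fun j => ?_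
      have h2 := congr_fun hφv j.succ
      rw [hφs] at h2
      simpa [tl, LinearMap.funLeft_apply] using h2
    funext i
    refine Fin.cases ?_ (fun i => ?_) i
    · simpa using hv0
    · have h3 := congr_fun htl0 i
      simpa [tl] using h3
  -- Step 5: the abstract variable reduction.
  have hΦCh : Φ (∑ i, mterm (T i)) ≠ 0 := map_sum_mterm_ne_zero Φ φ hΦ L k d hk T hTL hTd hCh
  -- Step 6: dehomogenise: `D' ∘ Φ = Ψ_K ∘ D`.
  let D' : MvPolynomial (Fin (k + 1)) K →ₐ[K] MvPolynomial (Fin k) K := aeval (Fin.cons 1 X)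
  have hcomm : D'.comp Φ = ΨK.comp D := by
    refine MvPolynomial.algHom_ext fun i => ?_
    refine Fin.cases ?_ (fun i => ?_) i
    · have hφe : φ (Pi.single 0 1) = Pi.single 0 1 := by
        funext j
        refine Fin.cases ?_ (fun j => ?_) j
        · simp [hφ0]
        · rw [hφs]
          simp [Fin.succ_ne_zero]
      rw [AlgHom.comp_apply, AlgHom.comp_apply]
      simp [D', Φ, D, hφe, linForm_single]
    · have hφe : φ (Pi.single i.succ 1) = Fin.cons 0 fun j : Fin k => t ^ ((i.1 + 1) * (j.1 + 1)) := by
        funext j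
        refine Fin.cases ?_ (fun j => ?_) j
        · simp [hφ0]
        · rw [hφs]
          simp [Pi.single_apply, Fin.succ_inj]
      rw [AlgHom.comp_apply, AlgHom.comp_apply]
      simp only [Φ, D, aeval_X, Fin.cons_succ, hφe]
      rw [aeval_linForm, Fin.sum_univ_succ]
      simp [ΨK, smul_eq_C_mul]
  have hhom : (Φ (∑ i, mterm (T i))).IsHomogeneous d := by
    rw [map_sum]
    simp_rw [map_mterm Φ φ hΦ]
    exact isHomogeneous_sum_mterm _ fun i => by rw [Multiset.card_map, hTd]
  apply hΦCh
  refine eq_zero_of_isHomogeneous_of_aeval_cons_one _ hhom ?_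
  have h4 := AlgHom.congr_fun hcomm (∑ i, mterm (T i))
  rw [AlgHom.comp_apply, AlgHom.comp_apply] at h4
  change D' (Φ (∑ i, mterm (T i))) = 0
  rw [h4, map_sum]
  have h5 : ∑ i, D (mterm (T i)) = MvPolynomial.map ι (∑ i, ∏ j, ℓ i j) := by
    rw [map_sum]
    exact Finset.sum_congr rfl fun i _ => by rw [hDT, map_prod]
  rw [h5]
  exact hΨK

end Main

end Assembly

end SaxenaSeshadhri

/-! ## The named fact -/

open MvPolynomial SaxenaSeshadhri in
/-- **Saxena–Seshadhri 2012, Lemma 11 / Theorem 2 (variable reduction for `ΣΠΣ(k, d, n)`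
circuits over any field)**: the named fact `SaxenaSeshadhri2012_lemma11` holds.  From the generic
statement `aeval_vandermonde_generic_ne_zero`: the substituted circuit is a nonzero polynomial in
`y` whose coefficients have degree `≤ d n k` in `t`, so fewer than `d n k² + 1` values `β` kill it.
[cite: SaxenaSeshadhri2012, Lemma 11 and Theorem 2] -/
theorem SaxenaSeshadhri2012_lemma11_holds : SaxenaSeshadhri2012_lemma11 := by
  intro F _ k d n dd hdd ℓ hℓ hC U hU
  classical
  set g : Fin n → MvPolynomial (Fin k) (Polynomial F) := fun i => ∑ j : Fin k,
    C (Polynomial.X ^ ((i.1 + 1) * (j.1 + 1)) : Polynomial F) * X j with hg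
  set P := aeval g (∑ i, ∏ j, ℓ i j) with hP
  have hP0 : P ≠ 0 := aeval_vandermonde_generic_ne_zero dd hdd ℓ hℓ hC
  -- specialisation `t ↦ β`
  have hspec : ∀ β : F, aeval (fun i : Fin n => ∑ j : Fin k, C (β ^ ((i.1 + 1) * (j.1 + 1))) * X j)
      (∑ i, ∏ j, ℓ i j) = MvPolynomial.map (Polynomial.evalRingHom β) P := by
    intro β
    have hcomp : (↑(aeval (R := F) fun i : Fin n => ∑ j : Fin k, C (β ^ ((i.1 + 1) * (j.1 + 1))) * X j) :
        MvPolynomial (Fin n) F →+* MvPolynomial (Fin k) F) =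
        (MvPolynomial.map (Polynomial.evalRingHom β)).comp ↑(aeval (R := F) g) := by
      refine MvPolynomial.ringHom_ext (fun c => ?_) (fun i => ?_)
      · simp
      · simp [hg, map_sum]
    exact RingHom.congr_fun hcomp _
  -- the `t`-degree of `P` is at most `d n k`
  have htot : (∑ i, ∏ j, ℓ i j).totalDegree ≤ d := by
    refine (totalDegree_finsetSum _ _).trans (Finset.sup_le fun i _ => ?_)
    refine (totalDegree_finsetProd _ _).trans ?_
    calc ∑ j, (ℓ i j).totalDegree ≤ ∑ _j : Fin (dd i), 1 := Finset.sum_le_sum fun j _ => hℓ i j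
      _ = dd i := by simp
      _ ≤ d := hdd i
  have hgdeg : ∀ i e, ((g i).coeff e).natDegree ≤ n * k := by
    intro i e
    rw [hg, coeff_sum]
    refine Polynomial.natDegree_sum_le_of_forall_le _ _ fun j _ => ?_
    rw [coeff_C_mul, coeff_X]
    split_ifs
    · rw [mul_one, Polynomial.natDegree_pow, Polynomial.natDegree_X, mul_one]
      exact Nat.mul_le_mul (by omega) (by omega)
    · simp
  have hdegP : ∀ e, (P.coeff e).natDegree ≤ d * (n * k) := natDegree_coeff_aeval_le _ htot g hgdeg
  -- a nonzero coefficient of `P` and a good `β`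
  obtain ⟨e, he⟩ := ne_zero_iff.mp hP0
  have hk1 : 1 ≤ k := Nat.pos_of_ne_zero (by
    rintro rfl
    exact hC (by simp))
  have hroots : (U.filter fun β => (P.coeff e).IsRoot β).card ≤ d * n * k := by
    calc (U.filter fun β => (P.coeff e).IsRoot β).card ≤ (P.coeff e).roots.toFinset.card := by
          refine Finset.card_le_card fun β hβ => ?_
          rw [Multiset.mem_toFinset, Polynomial.mem_roots he]
          exact (Finset.mem_filter.mp hβ).2
      _ ≤ Multiset.card (P.coeff e).roots := Multiset.toFinset_card_le _
      _ ≤ (P.coeff e).natDegree := Polynomial.card_roots' _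
      _ ≤ d * (n * k) := hdegP e
      _ = d * n * k := by ring
  have hlt : (U.filter fun β => (P.coeff e).IsRoot β).card < U.card := by
    calc _ ≤ d * n * k := hroots
      _ ≤ d * n * k ^ 2 := Nat.mul_le_mul_left _ (by nlinarith)
      _ < d * n * k ^ 2 + 1 := Nat.lt_succ_self _
      _ ≤ U.card := hU
  obtain ⟨β, hβU, hβ⟩ : ∃ β ∈ U, ¬ (P.coeff e).IsRoot β := by
    by_contra hall
    push Not at hall
    have hUeq : (U.filter fun β => (P.coeff e).IsRoot β) = U := Finset.filter_true_of_mem hall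
    rw [hUeq] at hlt
    exact lt_irrefl _ hlt
  refine ⟨β, hβU, fun h0 => hβ ?_⟩
  have h6 := congrArg (MvPolynomial.coeff e) (hspec β)
  rw [h0, coeff_zero, coeff_map] at h6
  simpa [Polynomial.IsRoot] using h6.symm

end Literature.Computability.AlgebraicComplexity
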